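import Summits.SmoothPoincare4.SmoothPoincare4.Theses.EntropyRung
import Literature.Geometry.Riemannian.RicciFlowMaximal
import Literature.Geometry.Riemannian.PerelmanEntropy
import Literature.Geometry.Riemannian.CanonicalNeighbourhoods
import Literature.Geometry.Riemannian.RicciFlowScaling
import Literature.Geometry.Riemannian.PerelmanEntropyScaling
import Literature.Topology.FourManifolds.HomotopyS4CompactProofs
import Summits.SmoothPoincare4.SmoothPoincare4.Theorems.EntropyRungSubcylindricalRecognitionPointPicking
import Summits.SmoothPoincare4.SmoothPoincare4.Theorems.EntropyRungSubcylindricalRecognitionRescaledSequence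
import Summits.SmoothPoincare4.SmoothPoincare4.Theorems.EntropyRungSubcylindricalRecognitionCompactModelRecognition
import Summits.SmoothPoincare4.SmoothPoincare4.Theorems.EntropyRungSubcylindricalRecognitionRenormalise
import Summits.SmoothPoincare4.SmoothPoincare4.Theorems.EntropyRungSubcylindricalRecognitionMuEntropyTestFunction
import Summits.SmoothPoincare4.SmoothPoincare4.Theorems.EntropyRungSubcylindricalRecognitionMultiplicityLintegral
import Literature.Geometry.Riemannian.PerelmanEntropyScaling
import Literature.Geometry.Riemannian.PerelmanEntropyCutoff
import Literature.Geometry.Riemannian.RicciFlowScaling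
import Literature.Geometry.Riemannian.MetricTraceScaling
import Literature.Geometry.Riemannian.RicciFlowScalarCurvatureHolds
import Literature.Topology.FourManifolds.WhitneyModelSheets
import Mathlib.Analysis.SpecialFunctions.SmoothTransition
import HarnessLib
import HarnessLib.Audit

/-!
# Line `ancient-sphere-rigidity` for crux `EntropyRung.SubcylindricalRecognition` (stmt-SmoothPoincare4-10869)

Skeleton, lead reshape **r5** (prover-line-stmt-SmoothPoincare4-10869-2, third lead, 2026-08-16) of r4
(gen-1 lead) of r3/r2 (gen-0 lead) of the planner's round-1 skeleton:
**type-agnostic blow-up, blow-down at `-∞`, density gaps** — and, new in r5, **cone-point exclusion on the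
compact approximants** by a Gaussian annulus test function for Perelman's `μ`.

## Status r5 (2026-08-16)
* LANDED (imported below, used by name): `stub_pointPicking` (p71490), `stub_rescaledSequence` (p71836),
  `stub_compactModelRecognition` (p72507), `stub_renormalise` (p74584).
* `stub_singularFlow`: PROVED MODULO the named facts F1 `ricciFlow_shortTime_existence`, F2
  `perelman_muEntropy_monotone` (`stub_singularFlow_of`, p72410). Registered signature unchanged since r2.
* r4's `stub_blowdownSoliton` (the Bamler core) is RESHAPED (r5) at the skeleton level into
  - `stub_orbifoldTangentFlow` — ONE named fact, a clause-by-clause export of PRINTED statements of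
    Bamler 2020a (Prop. 5.2 display `𝒩_{x,t}(τ) ≥ μ[g(t-τ), τ]`; Thm. 10.1 ε-regularity), 2020b
    (𝔽-compactness; smooth convergence on the regular part) and 2020c (Thms 4, 9, 15, 29, 35) in SMOOTH
    vocabulary: the regular part of the time `-1` slice of a tangent flow at `-∞` of the non-collapsed
    compact sequence is a smooth 4-manifold `S` with `f`, `W`: `Ric + ∇²f = g/2`, `R + |∇f|² = f - W`,
    `∫ e^{-f} = 16π²` (no mass on the singular part), `floor ≤ W < 0`, `R > 0` or a cone point exists;
    each cone point has a punctured orbifold chart `(B_r ∖ 0)/Γ`, `Γ ⊂ O(4)` free, exported through the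
    fibre cardinality `k ≥ 2` of the chart and the descent of `|y|²`, together with (1±η)-transplants of
    its compact sub-annuli into rescaled slices `λ g_k(t)` of the GIVEN compact flows (Thm 4); no cone
    point ⇒ complete, connected, and `S` compact ⇒ injective immersion `S → M` (Thm 4 again).
    To be filed as a Literature named fact (`stub_orbifoldTangentFlow_of : N1 → sig` is `id`).
  - four FACT-FREE stubs: `stub_muEntropyTestFunction` (`μ(g,τ) ≤ 𝒲̃(w)` for every smooth `w` with
    `∫ w² > 0`, Perelman (3.1) in the variable `φ`), `stub_injOnVolumeComparison` ((1±η)² two-sided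
    comparison of `Vol_g(Φ S)` with Lebesgue measure for an injective piece of a (1±η)-almost isometric
    immersion `Φ` of an open subset of `ℝ⁴`), `stub_multiplicityLintegral` (the `k`-sheeted version for
    integrals, from the injective one), `stub_coneAnnulusArithmetic` (the Gaussian annulus arithmetic in
    `ℝ⁴`: the test-function bound tends to `-log k`);
  - `stub_blowdownAssembly` — the glue (lead): unpack the export; if a cone point exists, choose
    `η, r', τ, ε`, transplant, build the `Γ`-invariant test function `w = e^{-ρ/8τ} cut(ρ)` on
    `(M, λ g_k(t))`, and get `μ(λ g_k(t), τ) < ν_cyl + δ'` from the four fact-free stubs — contradicting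
    the floor (`μ(λ g, τ) = μ(g, τ/λ)`, `muEntropy_constSmul'`); so there is no cone point, `S` is
    complete with `R > 0`, and r4's `stub_blowdownSoliton` follows verbatim (`stub_blowdownSoliton_derived`).
* Sorries r5: 7 registered stubs (`stub_singularFlow` closed in the tree modulo F1+F2; the other six open).

Chain: `(M, g₀)` closed, `M ≃ₕ S⁴`, `R > 0`, `ν > ν_cyl`
  —[stub_singularFlow]→ maximal flow, `T < ∞`, blow-up, `κ`-NLC, floor `μ ≥ ν_cyl + δ'`
  —[stub_pointPicking]→ `(x_k, t_k, Q_k)` —[stub_rescaledSequence]→ flows on `M × [-A_k, 0]`,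
  `|Rm| ≤ 1`, `|Rm|(x_k,0) ≥ c`, floor —[stub_orbifoldTangentFlow]→ orbifold shrinker export
  —[stub_muEntropyTestFunction, stub_injOnVolumeComparison, stub_multiplicityLintegral,
    stub_coneAnnulusArithmetic; stub_blowdownAssembly]→ complete smooth shrinker `S` in Bamler's
  normalisation, `W ≥ ν_cyl + δ'`, `R > 0`, compact ⇒ injective immersion `S → M`
  —[stub_renormalise]→ route normalisation —[stub_compactModelRecognition; #2; #4]→ `M ≃ₘ S⁴`.
-/

noncomputable section

open scoped Manifold ContDiff Topology ENNReal NNReal ContinuousMap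
open Set MeasureTheory Filter
open Literature.Geometry.Lorentzian Literature.Geometry.Riemannian

namespace Summit.SmoothPoincare4.SmoothPoincare4.Cruxes.SubcylindricalRecognition.AncientSphereRigidity

/-! ## Stub 1a — the singular flow with Perelman's floor (Hamilton 1982; Perelman 2002 §3.1, §4)

STATUS: PROVED MODULO the two named facts — the tree theorem
`Summit.SmoothPoincare4.SmoothPoincare4.Theorems.SubcylindricalRecognition.AncientSphereRigidity.stub_singularFlow_of :
ricciFlow_shortTime_existence.{0,0,0} → perelman_muEntropy_monotone.{0,0,0} → <this signature>`
(Theorems/EntropyRungSubcylindricalRecognitionSingularFlow.lean, p72410). This `sorry` closes by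
`stub_singularFlow_of F1_holds F2_holds` once the two `_holds` theorems exist. -/
theorem stub_singularFlow :
    ∀ (M : Type) [TopologicalSpace M] [T2Space M] [SecondCountableTopology M]
      [ChartedSpace (EuclideanSpace ℝ (Fin 4)) M] [IsManifold (𝓡 4) ∞ M] [CompactSpace M]
      [ConnectedSpace M] [T3Space M] [MeasurableSpace M] [BorelSpace M]
      (g₀ : PseudoRiemannianMetric (𝓡 4) ∞ (EuclideanSpace ℝ (Fin 4)) (TangentSpace (𝓡 4) : M → Type _))
      [g₀.HasLeviCivita] (hg₀ : g₀.IsRiemannian),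
      (∀ x : M, 0 < g₀.scalarCurvature x) →
      ∀ δ : ℝ, 0 < δ →
      (∀ τ : ℝ, 0 < τ → ∀ f : M → ℝ, ContMDiff (𝓡 4) 𝓘(ℝ, ℝ) ∞ f →
        ∫ x, (4 * Real.pi * τ) ^ (-(4 : ℝ) / 2) * Real.exp (-f x)
          ∂(riemannianMeasure (g₀.toContMDiffRiemannianMetric hg₀)) = 1 →
        Real.log 2 + Real.log Real.pi / 2 - 3 / 2 + δ ≤
          ∫ x, (τ * (g₀.scalarCurvature x + g₀.gradSq f x) + f x - 4) *
            ((4 * Real.pi * τ) ^ (-(4 : ℝ) / 2) * Real.exp (-f x))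
            ∂(riemannianMeasure (g₀.toContMDiffRiemannianMetric hg₀))) →
      ∃ (T κ : ℝ), 0 < κ ∧
        ∃ (g : ℝ → PseudoRiemannianMetric (𝓡 4) ∞ (EuclideanSpace ℝ (Fin 4)) (TangentSpace (𝓡 4) : M → Type _))
          (cov : ℝ → CovariantDerivative (𝓡 4) (EuclideanSpace ℝ (Fin 4)) (TangentSpace (𝓡 4) : M → Type _)),
          IsMaximalRicciFlow g cov T ∧ g 0 = g₀ ∧
          (∀ C : ℝ, ∃ t₀ ∈ Set.Ico 0 T, ∀ t ∈ Set.Ico t₀ T, ¬ CurvatureBoundedBy (g t) (cov t) C) ∧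
          (∀ r₀ : ℝ, 0 < r₀ → r₀ < Real.sqrt T → IsKappaNoncollapsed g cov (Set.Ico 0 T) κ r₀) ∧
          (∀ t ∈ Set.Ico 0 T, ∀ τ : ℝ, 0 < τ →
            ((Real.log 2 + Real.log Real.pi / 2 - 3 / 2 + δ : ℝ) : EReal) ≤
              (g t).muEntropy (cov t) τ) := by
  sorry

/-! ## Stub 1b, 1c — point picking, parabolic rescaling: CLOSED (p71490, p71836; used below by name). -/

/-! ## Stub 2 (r5) — Bamler's tangent flow at `-∞` of a non-collapsed sequence of COMPACT
4-dimensional Ricci flows, exported in smooth vocabulary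

Printed sources, clause by clause (arXiv numbering of Bamler 2020c = arXiv:2009.03243v2 "Structure theory of
non-collapsed limits of Ricci flows"; 2020a = arXiv:2008.07093 "Entropy and heat kernel bounds on a Ricci
flow background"; 2020b = "Compactness theory of the space of super Ricci flows", Invent. Math. 233 (2023)):
* hypotheses = the setting of 2020c §2.7 ("pointed Ricci flows on compact manifolds, `T_i → ∞`,
  `𝒩_{x_i,0}(τ₀) ≥ -Y₀`; such a sequence arises when we take the blow-ups near singularities"), the
  Nash-entropy bound being supplied by the `μ`-floor through the display after 2020a Prop. 5.2,
  `𝒩_{x₀,t₀}(τ) ≥ μ[g_{t₀-τ}, τ]`;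
* `S, g, f, W`, the soliton identities and the probability normalisation: 2020c Thm 29 (every tangent flow at
  infinity is a metric soliton with `𝒩 ≡ W := 𝒩_𝒳(∞)`, itself an 𝔽-limit of rescalings of the `(M, g_k)`) and
  Thm 15 (`Ric + ∇²f = g/2τ`, `-τ(R + |∇f|²) + f = W`, `dμ = (4πτ)^{-n/2} e^{-f} dg` a probability measure with
  `μ(𝒮_X) = 0`), at `τ = 1`, `S := ℛ_X`;
* `F ≤ W`: §2.7 ("the bound passes to the limit … `𝒩_𝒳(∞)` is independent of the basepoint") with Thm 9;
  `W < 0`: Thm 29 (`𝒩_𝒳(∞) ≥ -ε_n ⇒ 𝒳` Euclidean) with 2020a Thm 10.1 (`𝒩_{x,t}(r²) ≥ -ε ⇒ |Rm|(x,t) ≤ (εr)⁻²`)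
  and Thm 9 applied at the anchor `|Rm|(x_k, 0) ≥ c > 0`;
* `R > 0 ∨` a cone point: Thm 15 ("`X` is a metric cone or `R > 0` on `ℛ_X`") with Thm 35 (n = 4: `X` is a
  complete smooth Riemannian orbifold with isolated singularities; a metric cone is `ℝ⁴/Γ`), the vertex of
  `ℝ⁴/Γ`, `Γ ≠ 1`, being a cone point and `Γ = 1` being excluded by `W < 0` (the Gaussian soliton has `W = 0`);
* cone charts: Thm 35 (orbifold chart `B_r/Γ`, `Γ ⊂ O(4)` acting freely, the metric extending smoothly over
  `0`; linearly normalised to be Euclidean at `0`, so `|y|²` is `Γ`-invariant and the fibres of the chart are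
  the `Γ`-orbits, of cardinality `|Γ| = k ≥ 2`); transplants and the coupling: Thm 4 (the 𝔽-convergence of
  the rescaled flows `λ_j g_{k_j}(λ_j⁻¹ ·)` to the tangent flow at infinity is smooth on its regular part),
  restricted to compact sub-annuli of the punctured chart, resp. to `S × {-1}` when `S` is compact;
* no cone point ⇒ complete: Def. 12 / Thm 35 (`X` is the completion of `ℛ_X`), and connected.
OPEN here; named fact to be filed under Literature/Geometry/Riemannian (BamlerTangentFlowAtInfinity). -/

/-- **Statement of Stub 2** (Bamler's orbifold tangent flow at `-∞`, smooth export; see the section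
docstring for the printed sources of each clause). [cite: Bamler2020Structure, Thm 4, 9, 15, 29, 35] -/
def OrbifoldTangentFlowExport : Prop :=
    ∀ (M : Type) [TopologicalSpace M] [T2Space M] [SecondCountableTopology M]
      [ChartedSpace (EuclideanSpace ℝ (Fin 4)) M] [IsManifold (𝓡 4) ∞ M] [CompactSpace M]
      [ConnectedSpace M] [T3Space M] [MeasurableSpace M] [BorelSpace M]
      (A : ℕ → ℝ)
      (gk : ℕ → ℝ → PseudoRiemannianMetric (𝓡 4) ∞ (EuclideanSpace ℝ (Fin 4)) (TangentSpace (𝓡 4) : M → Type _))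
      (covk : ℕ → ℝ → CovariantDerivative (𝓡 4) (EuclideanSpace ℝ (Fin 4)) (TangentSpace (𝓡 4) : M → Type _))
      (xk : ℕ → M) (F c : ℝ), 0 < c →
      (∀ k : ℕ, (k : ℝ) ≤ A k) →
      (∀ k, IsRicciFlow (gk k) (covk k) (Set.Icc (-(A k)) 0)) →
      (∀ k, ∀ t ∈ Set.Icc (-(A k)) 0, (gk k t).IsRiemannian) →
      (∀ k, ∀ t ∈ Set.Icc (-(A k)) 0, CurvatureBoundedBy (gk k t) (covk k t) 1) →
      (∀ k, ∃ X Y Z W : TangentSpace (𝓡 4) (xk k),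
        (gk k 0).val (xk k) X X ≤ 1 ∧ (gk k 0).val (xk k) Y Y ≤ 1 ∧
        (gk k 0).val (xk k) Z Z ≤ 1 ∧ (gk k 0).val (xk k) W W ≤ 1 ∧
        c ≤ |(gk k 0).curvatureForm (covk k 0) (xk k) X Y Z W|) →
      (∀ k, ∀ t ∈ Set.Icc (-(A k)) 0, ∀ τ : ℝ, 0 < τ → ((F : ℝ) : EReal) ≤ (gk k t).muEntropy (covk k t) τ) →
      ∃ (S : Type) (_ : TopologicalSpace S) (_ : T2Space S) (_ : SecondCountableTopology S)
        (_ : ChartedSpace (EuclideanSpace ℝ (Fin 4)) S) (_ : IsManifold (𝓡 4) ∞ S)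
        (_ : T3Space S) (_ : MeasurableSpace S) (_ : BorelSpace S)
        (gS : PseudoRiemannianMetric (𝓡 4) ∞ (EuclideanSpace ℝ (Fin 4)) (TangentSpace (𝓡 4) : S → Type _))
        (_ : gS.HasLeviCivita) (f : S → ℝ) (hS : gS.IsRiemannian) (W : ℝ)
        -- cone data: index type, sheet numbers, chart radii, scalar-curvature bounds, orbifold chart metrics
        (ι : Type) (kc : ι → ℕ) (rc Λc : ι → ℝ)
        (gc : ι → EuclideanSpace ℝ (Fin 4) →
          (EuclideanSpace ℝ (Fin 4) →L[ℝ] EuclideanSpace ℝ (Fin 4) →L[ℝ] ℝ)),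
        -- (E1) soliton identities in Bamler's normalisation (2020c Thm 15 at τ = 1)
        ContMDiff (𝓡 4) 𝓘(ℝ, ℝ) ∞ f ∧
        (∀ (x : S) (X Y : TangentSpace (𝓡 4) x),
          gS.ricci x X Y + gS.hessian f x X Y = (1 / 2 : ℝ) * gS.val x X Y) ∧
        (∀ x : S, gS.scalarCurvature x + gS.gradSq f x = f x - W) ∧
        -- (E2) `(4π)⁻² e^{-f} dg` is a probability measure on the regular part (μ(𝒮_X) = 0)
        ∫⁻ x, ENNReal.ofReal (Real.exp (-f x))
            ∂(riemannianMeasure (gS.toContMDiffRiemannianMetric hS)) =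
          ENNReal.ofReal (16 * Real.pi ^ 2) ∧
        -- (E3) entropy: the floor passes to `W = 𝒩_𝒳(∞)`; the anchor makes the limit non-flat
        F ≤ W ∧ W < 0 ∧
        -- (E4) Thm 15/35 dichotomy: positive scalar curvature, or a cone point
        ((∀ x : S, 0 < gS.scalarCurvature x) ∨ Nonempty ι) ∧
        -- (E5) orbifold chart metrics at the cone points, Euclidean at the vertex
        (∀ i, 2 ≤ kc i ∧ 0 < rc i ∧ 0 ≤ Λc i ∧
          ContDiffOn ℝ ∞ (gc i) (Metric.ball 0 (rc i)) ∧
          (∀ v w : EuclideanSpace ℝ (Fin 4), gc i 0 v w = inner ℝ v w) ∧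
          (∀ y ∈ Metric.ball (0 : EuclideanSpace ℝ (Fin 4)) (rc i), ∀ v w, gc i y v w = gc i y w v) ∧
          (∀ y ∈ Metric.ball (0 : EuclideanSpace ℝ (Fin 4)) (rc i), ∀ v, v ≠ 0 → 0 < gc i y v v)) ∧
        -- (E6a) transplants of compact sub-annuli of the punctured cone charts into rescaled slices of the
        -- given compact flows (smooth convergence on the regular part, 2020c Thm 4), `k`-sheeted with the
        -- descent `ρ` of `|y|²`, (1±η)-isometric, with scalar curvature control
        (∀ i, ∀ ε η : ℝ, 0 < ε → ε < rc i → 0 < η →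
          ∃ (k : ℕ) (t : ℝ) (_ : t ∈ Set.Icc (-(A k)) 0) (Q : ℝ) (_ : 0 < Q)
            (Φ : EuclideanSpace ℝ (Fin 4) → M) (ρ : M → ℝ),
            ContMDiffOn (𝓡 4) (𝓡 4) ∞ Φ (Metric.ball 0 (rc i) \ Metric.closedBall 0 ε) ∧
            IsOpen (Φ '' (Metric.ball 0 (rc i) \ Metric.closedBall 0 ε)) ∧
            (∀ y ∈ Metric.ball (0 : EuclideanSpace ℝ (Fin 4)) (rc i) \ Metric.closedBall 0 ε,
              Function.Injective (mfderiv (𝓡 4) (𝓡 4) Φ y)) ∧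
            (∀ y ∈ Metric.ball (0 : EuclideanSpace ℝ (Fin 4)) (rc i) \ Metric.closedBall 0 ε,
              (Φ ⁻¹' {Φ y} ∩ (Metric.ball 0 (rc i) \ Metric.closedBall 0 ε)).ncard = kc i) ∧
            ContMDiffOn (𝓡 4) 𝓘(ℝ, ℝ) ∞ ρ (Φ '' (Metric.ball 0 (rc i) \ Metric.closedBall 0 ε)) ∧
            (∀ y ∈ Metric.ball (0 : EuclideanSpace ℝ (Fin 4)) (rc i) \ Metric.closedBall 0 ε,
              ρ (Φ y) = ‖y‖ ^ 2) ∧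
            (∀ y ∈ Metric.ball (0 : EuclideanSpace ℝ (Fin 4)) (rc i) \ Metric.closedBall 0 ε,
              ∀ v : EuclideanSpace ℝ (Fin 4),
                (1 - η) * gc i y v v ≤
                  Q * (gk k t).val (Φ y) (mfderiv (𝓡 4) (𝓡 4) Φ y v) (mfderiv (𝓡 4) (𝓡 4) Φ y v) ∧
                Q * (gk k t).val (Φ y) (mfderiv (𝓡 4) (𝓡 4) Φ y v) (mfderiv (𝓡 4) (𝓡 4) Φ y v) ≤
                  (1 + η) * gc i y v v) ∧
            (∀ y ∈ Metric.ball (0 : EuclideanSpace ℝ (Fin 4)) (rc i) \ Metric.closedBall 0 ε,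
              |(gk k t).scalarCurvatureWith (covk k t) (Φ y)| ≤ Q * Λc i)) ∧
        -- (E6b, E7) no cone point: connected, complete, and compact ⇒ injective immersion into `M` (Thm 4)
        (IsEmpty ι → ConnectedSpace S) ∧
        (IsEmpty ι → ∀ (x : S) (r : NNReal), IsCompact {y : S | gS.edist hS x y ≤ r}) ∧
        (IsEmpty ι → CompactSpace S → ∃ φ : S → M, ContMDiff (𝓡 4) (𝓡 4) ∞ φ ∧ Function.Injective φ ∧
          ∀ x : S, Function.Injective (mfderiv (𝓡 4) (𝓡 4) φ x))

/-- **Stub 2** — Bamler's orbifold tangent flow at `-∞` (smooth export), OPEN: to be the named fact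
`Literature.Geometry.Riemannian.bamler_orbifoldTangentFlowAtInfinity_four`. [cite: Bamler2020Structure, Thm 4, 9, 15, 29, 35] -/
theorem stub_orbifoldTangentFlow :
    ∀ (M : Type) [TopologicalSpace M] [T2Space M] [SecondCountableTopology M]
      [ChartedSpace (EuclideanSpace ℝ (Fin 4)) M] [IsManifold (𝓡 4) ∞ M] [CompactSpace M]
      [ConnectedSpace M] [T3Space M] [MeasurableSpace M] [BorelSpace M]
      (A : ℕ → ℝ)
      (gk : ℕ → ℝ → PseudoRiemannianMetric (𝓡 4) ∞ (EuclideanSpace ℝ (Fin 4)) (TangentSpace (𝓡 4) : M → Type _))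
      (covk : ℕ → ℝ → CovariantDerivative (𝓡 4) (EuclideanSpace ℝ (Fin 4)) (TangentSpace (𝓡 4) : M → Type _))
      (xk : ℕ → M) (F c : ℝ), 0 < c →
      (∀ k : ℕ, (k : ℝ) ≤ A k) →
      (∀ k, IsRicciFlow (gk k) (covk k) (Set.Icc (-(A k)) 0)) →
      (∀ k, ∀ t ∈ Set.Icc (-(A k)) 0, (gk k t).IsRiemannian) →
      (∀ k, ∀ t ∈ Set.Icc (-(A k)) 0, CurvatureBoundedBy (gk k t) (covk k t) 1) →
      (∀ k, ∃ X Y Z W : TangentSpace (𝓡 4) (xk k),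
        (gk k 0).val (xk k) X X ≤ 1 ∧ (gk k 0).val (xk k) Y Y ≤ 1 ∧
        (gk k 0).val (xk k) Z Z ≤ 1 ∧ (gk k 0).val (xk k) W W ≤ 1 ∧
        c ≤ |(gk k 0).curvatureForm (covk k 0) (xk k) X Y Z W|) →
      (∀ k, ∀ t ∈ Set.Icc (-(A k)) 0, ∀ τ : ℝ, 0 < τ → ((F : ℝ) : EReal) ≤ (gk k t).muEntropy (covk k t) τ) →
      ∃ (S : Type) (_ : TopologicalSpace S) (_ : T2Space S) (_ : SecondCountableTopology S)
        (_ : ChartedSpace (EuclideanSpace ℝ (Fin 4)) S) (_ : IsManifold (𝓡 4) ∞ S)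
        (_ : T3Space S) (_ : MeasurableSpace S) (_ : BorelSpace S)
        (gS : PseudoRiemannianMetric (𝓡 4) ∞ (EuclideanSpace ℝ (Fin 4)) (TangentSpace (𝓡 4) : S → Type _))
        (_ : gS.HasLeviCivita) (f : S → ℝ) (hS : gS.IsRiemannian) (W : ℝ)
        -- cone data: index type, sheet numbers, chart radii, scalar-curvature bounds, orbifold chart metrics
        (ι : Type) (kc : ι → ℕ) (rc Λc : ι → ℝ)
        (gc : ι → EuclideanSpace ℝ (Fin 4) →
          (EuclideanSpace ℝ (Fin 4) →L[ℝ] EuclideanSpace ℝ (Fin 4) →L[ℝ] ℝ)),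
        -- (E1) soliton identities in Bamler's normalisation (2020c Thm 15 at τ = 1)
        ContMDiff (𝓡 4) 𝓘(ℝ, ℝ) ∞ f ∧
        (∀ (x : S) (X Y : TangentSpace (𝓡 4) x),
          gS.ricci x X Y + gS.hessian f x X Y = (1 / 2 : ℝ) * gS.val x X Y) ∧
        (∀ x : S, gS.scalarCurvature x + gS.gradSq f x = f x - W) ∧
        -- (E2) `(4π)⁻² e^{-f} dg` is a probability measure on the regular part (μ(𝒮_X) = 0)
        ∫⁻ x, ENNReal.ofReal (Real.exp (-f x))
            ∂(riemannianMeasure (gS.toContMDiffRiemannianMetric hS)) =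
          ENNReal.ofReal (16 * Real.pi ^ 2) ∧
        -- (E3) entropy: the floor passes to `W = 𝒩_𝒳(∞)`; the anchor makes the limit non-flat
        F ≤ W ∧ W < 0 ∧
        -- (E4) Thm 15/35 dichotomy: positive scalar curvature, or a cone point
        ((∀ x : S, 0 < gS.scalarCurvature x) ∨ Nonempty ι) ∧
        -- (E5) orbifold chart metrics at the cone points, Euclidean at the vertex
        (∀ i, 2 ≤ kc i ∧ 0 < rc i ∧ 0 ≤ Λc i ∧
          ContDiffOn ℝ ∞ (gc i) (Metric.ball 0 (rc i)) ∧
          (∀ v w : EuclideanSpace ℝ (Fin 4), gc i 0 v w = inner ℝ v w) ∧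
          (∀ y ∈ Metric.ball (0 : EuclideanSpace ℝ (Fin 4)) (rc i), ∀ v w, gc i y v w = gc i y w v) ∧
          (∀ y ∈ Metric.ball (0 : EuclideanSpace ℝ (Fin 4)) (rc i), ∀ v, v ≠ 0 → 0 < gc i y v v)) ∧
        -- (E6a) transplants of compact sub-annuli of the punctured cone charts into rescaled slices of the
        -- given compact flows (smooth convergence on the regular part, 2020c Thm 4), `k`-sheeted with the
        -- descent `ρ` of `|y|²`, (1±η)-isometric, with scalar curvature control
        (∀ i, ∀ ε η : ℝ, 0 < ε → ε < rc i → 0 < η →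
          ∃ (k : ℕ) (t : ℝ) (_ : t ∈ Set.Icc (-(A k)) 0) (Q : ℝ) (_ : 0 < Q)
            (Φ : EuclideanSpace ℝ (Fin 4) → M) (ρ : M → ℝ),
            ContMDiffOn (𝓡 4) (𝓡 4) ∞ Φ (Metric.ball 0 (rc i) \ Metric.closedBall 0 ε) ∧
            IsOpen (Φ '' (Metric.ball 0 (rc i) \ Metric.closedBall 0 ε)) ∧
            (∀ y ∈ Metric.ball (0 : EuclideanSpace ℝ (Fin 4)) (rc i) \ Metric.closedBall 0 ε,
              Function.Injective (mfderiv (𝓡 4) (𝓡 4) Φ y)) ∧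
            (∀ y ∈ Metric.ball (0 : EuclideanSpace ℝ (Fin 4)) (rc i) \ Metric.closedBall 0 ε,
              (Φ ⁻¹' {Φ y} ∩ (Metric.ball 0 (rc i) \ Metric.closedBall 0 ε)).ncard = kc i) ∧
            ContMDiffOn (𝓡 4) 𝓘(ℝ, ℝ) ∞ ρ (Φ '' (Metric.ball 0 (rc i) \ Metric.closedBall 0 ε)) ∧
            (∀ y ∈ Metric.ball (0 : EuclideanSpace ℝ (Fin 4)) (rc i) \ Metric.closedBall 0 ε,
              ρ (Φ y) = ‖y‖ ^ 2) ∧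
            (∀ y ∈ Metric.ball (0 : EuclideanSpace ℝ (Fin 4)) (rc i) \ Metric.closedBall 0 ε,
              ∀ v : EuclideanSpace ℝ (Fin 4),
                (1 - η) * gc i y v v ≤
                  Q * (gk k t).val (Φ y) (mfderiv (𝓡 4) (𝓡 4) Φ y v) (mfderiv (𝓡 4) (𝓡 4) Φ y v) ∧
                Q * (gk k t).val (Φ y) (mfderiv (𝓡 4) (𝓡 4) Φ y v) (mfderiv (𝓡 4) (𝓡 4) Φ y v) ≤
                  (1 + η) * gc i y v v) ∧
            (∀ y ∈ Metric.ball (0 : EuclideanSpace ℝ (Fin 4)) (rc i) \ Metric.closedBall 0 ε,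
              |(gk k t).scalarCurvatureWith (covk k t) (Φ y)| ≤ Q * Λc i)) ∧
        -- (E6b, E7) no cone point: connected, complete, and compact ⇒ injective immersion into `M` (Thm 4)
        (IsEmpty ι → ConnectedSpace S) ∧
        (IsEmpty ι → ∀ (x : S) (r : NNReal), IsCompact {y : S | gS.edist hS x y ≤ r}) ∧
        (IsEmpty ι → CompactSpace S → ∃ φ : S → M, ContMDiff (𝓡 4) (𝓡 4) ∞ φ ∧ Function.Injective φ ∧
          ∀ x : S, Function.Injective (mfderiv (𝓡 4) (𝓡 4) φ x)) := by
  sorry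

/-! ## Stubs 3–6 (r5) — the fact-free cone-exclusion kit on a closed Riemannian 4-manifold -/

/-- **Statement of Stub 3** — the test-function upper bound for Perelman's `μ` (Perelman 2002, (3.1) with
`φ² ∝ e^{-f}`; Topping 2006, (8.1.8)): for every smooth `w` on a closed Riemannian 4-manifold with
`Z = ∫ w² dV > 0`,
`μ(g, τ) ≤ Z⁻¹ ∫ [τ(R w² + 4|∇w|²) - w² log w²] dV + log Z - 2 log(4πτ) - 4`
(the value of `𝒲(g, f, τ)` at `(4πτ)⁻² e^{-f} = w²/Z`, reached through the smooth compatible family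
`f_δ = c_δ - log(w² + δ²)`, `δ → 0`, as in `PerelmanEntropyCutoff.wEntropy_cutoffTest_le`). [cite: Perelman2002, §3.1, (3.1)] -/
def MuEntropyTestFunctionBound : Prop :=
    ∀ (M : Type) [TopologicalSpace M] [T2Space M] [SecondCountableTopology M]
      [ChartedSpace (EuclideanSpace ℝ (Fin 4)) M] [IsManifold (𝓡 4) ∞ M] [CompactSpace M]
      [T3Space M] [MeasurableSpace M] [BorelSpace M]
      (g : PseudoRiemannianMetric (𝓡 4) ∞ (EuclideanSpace ℝ (Fin 4)) (TangentSpace (𝓡 4) : M → Type _))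
      (hg : g.IsRiemannian)
      (cov : CovariantDerivative (𝓡 4) (EuclideanSpace ℝ (Fin 4)) (TangentSpace (𝓡 4) : M → Type _)),
      Continuous (fun x ↦ g.scalarCurvatureWith cov x) →
      ∀ τ : ℝ, 0 < τ → ∀ w : M → ℝ, ContMDiff (𝓡 4) 𝓘(ℝ, ℝ) ∞ w →
      0 < ∫ x, w x ^ 2 ∂g.riemVolume →
      g.muEntropy cov τ ≤
        (((∫ x, (τ * (g.scalarCurvatureWith cov x * w x ^ 2 + 4 * g.gradSq w x)
              - w x ^ 2 * Real.log (w x ^ 2)) ∂g.riemVolume) / (∫ x, w x ^ 2 ∂g.riemVolume)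
            + Real.log (∫ x, w x ^ 2 ∂g.riemVolume) - 2 * Real.log (4 * Real.pi * τ) - 4 : ℝ) : EReal)

/-- **Stub 3** — test-function bound for `μ`, OPEN (fact-free). [cite: Perelman2002, §3.1, (3.1)] -/
theorem stub_muEntropyTestFunction :
    ∀ (M : Type) [TopologicalSpace M] [T2Space M] [SecondCountableTopology M]
      [ChartedSpace (EuclideanSpace ℝ (Fin 4)) M] [IsManifold (𝓡 4) ∞ M] [CompactSpace M]
      [T3Space M] [MeasurableSpace M] [BorelSpace M]
      (g : PseudoRiemannianMetric (𝓡 4) ∞ (EuclideanSpace ℝ (Fin 4)) (TangentSpace (𝓡 4) : M → Type _))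
      (hg : g.IsRiemannian)
      (cov : CovariantDerivative (𝓡 4) (EuclideanSpace ℝ (Fin 4)) (TangentSpace (𝓡 4) : M → Type _)),
      Continuous (fun x ↦ g.scalarCurvatureWith cov x) →
      ∀ τ : ℝ, 0 < τ → ∀ w : M → ℝ, ContMDiff (𝓡 4) 𝓘(ℝ, ℝ) ∞ w →
      0 < ∫ x, w x ^ 2 ∂g.riemVolume →
      g.muEntropy cov τ ≤
        (((∫ x, (τ * (g.scalarCurvatureWith cov x * w x ^ 2 + 4 * g.gradSq w x)
              - w x ^ 2 * Real.log (w x ^ 2)) ∂g.riemVolume) / (∫ x, w x ^ 2 ∂g.riemVolume)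
            + Real.log (∫ x, w x ^ 2 ∂g.riemVolume) - 2 * Real.log (4 * Real.pi * τ) - 4 : ℝ) : EReal) :=
  _root_.Summit.SmoothPoincare4.SmoothPoincare4.Theorems.SubcylindricalRecognition.AncientSphereRigidity.stub_muEntropyTestFunction

/-- **Statement of Stub 4** — two-sided volume comparison for an injective piece of an almost-isometric
immersion of an open subset of `ℝ⁴` (Federer 1969 §3.2.3/§3.2.46 area formula; in the tree:
`riemannianMeasure_eq_integral_sqrt_det_holds`, `AreaFormula.lean`): if `Φ` is smooth and injective on the
open `U ⊆ ℝ⁴` with `(1-η)|v|² ≤ g(dΦ v, dΦ v) ≤ (1+η)|v|²`, then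
`(1-η)² Leb(S) ≤ Vol_g(Φ S) ≤ (1+η)² Leb(S)` for measurable `S ⊆ U`
(`√det` of a Gram matrix with eigenvalues in `[1-η, 1+η]` lies in `[(1-η)², (1+η)²]`). [cite: Federer1969, §3.2.3] -/
def InjOnVolumeComparison : Prop :=
    ∀ (M : Type) [TopologicalSpace M] [T2Space M] [SecondCountableTopology M]
      [ChartedSpace (EuclideanSpace ℝ (Fin 4)) M] [IsManifold (𝓡 4) ∞ M]
      [T3Space M] [MeasurableSpace M] [BorelSpace M]
      (g : PseudoRiemannianMetric (𝓡 4) ∞ (EuclideanSpace ℝ (Fin 4)) (TangentSpace (𝓡 4) : M → Type _))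
      (_hg : g.IsRiemannian) (Φ : EuclideanSpace ℝ (Fin 4) → M) (U : Set (EuclideanSpace ℝ (Fin 4)))
      (η : ℝ), 0 ≤ η → η < 1 → IsOpen U → ContMDiffOn (𝓡 4) (𝓡 4) ∞ Φ U → Set.InjOn Φ U →
      (∀ y ∈ U, ∀ v : EuclideanSpace ℝ (Fin 4),
        (1 - η) * ‖v‖ ^ 2 ≤ g.val (Φ y) (mfderiv (𝓡 4) (𝓡 4) Φ y v) (mfderiv (𝓡 4) (𝓡 4) Φ y v) ∧
        g.val (Φ y) (mfderiv (𝓡 4) (𝓡 4) Φ y v) (mfderiv (𝓡 4) (𝓡 4) Φ y v) ≤ (1 + η) * ‖v‖ ^ 2) →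
      ∀ S ⊆ U, MeasurableSet S →
        ENNReal.ofReal ((1 - η) ^ 2) * volume S ≤ g.riemVolume (Φ '' S) ∧
        g.riemVolume (Φ '' S) ≤ ENNReal.ofReal ((1 + η) ^ 2) * volume S

/-- **Stub 4** — injective-piece volume comparison, OPEN (fact-free). [cite: Federer1969, §3.2.3] -/
theorem stub_injOnVolumeComparison :
    ∀ (M : Type) [TopologicalSpace M] [T2Space M] [SecondCountableTopology M]
      [ChartedSpace (EuclideanSpace ℝ (Fin 4)) M] [IsManifold (𝓡 4) ∞ M]
      [T3Space M] [MeasurableSpace M] [BorelSpace M]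
      (g : PseudoRiemannianMetric (𝓡 4) ∞ (EuclideanSpace ℝ (Fin 4)) (TangentSpace (𝓡 4) : M → Type _))
      (_hg : g.IsRiemannian) (Φ : EuclideanSpace ℝ (Fin 4) → M) (U : Set (EuclideanSpace ℝ (Fin 4)))
      (η : ℝ), 0 ≤ η → η < 1 → IsOpen U → ContMDiffOn (𝓡 4) (𝓡 4) ∞ Φ U → Set.InjOn Φ U →
      (∀ y ∈ U, ∀ v : EuclideanSpace ℝ (Fin 4),
        (1 - η) * ‖v‖ ^ 2 ≤ g.val (Φ y) (mfderiv (𝓡 4) (𝓡 4) Φ y v) (mfderiv (𝓡 4) (𝓡 4) Φ y v) ∧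
        g.val (Φ y) (mfderiv (𝓡 4) (𝓡 4) Φ y v) (mfderiv (𝓡 4) (𝓡 4) Φ y v) ≤ (1 + η) * ‖v‖ ^ 2) →
      ∀ S ⊆ U, MeasurableSet S →
        ENNReal.ofReal ((1 - η) ^ 2) * volume S ≤ g.riemVolume (Φ '' S) ∧
        g.riemVolume (Φ '' S) ≤ ENNReal.ofReal ((1 + η) ^ 2) * volume S := by
  sorry

/-- **Statement of Stub 5** — the `k`-sheeted comparison for integrals (area formula with constant
multiplicity, assembled from an injective-piece comparison taken as HYPOTHESIS with constants `c₁, c₂`):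
if `Φ` is smooth on the open `A ⊆ ℝ⁴`, locally injective, with open image and all fibres over the image of
cardinality `k ≥ 1`, then for every measurable `G ≥ 0` on `M`,
`c₁ ∫_A G∘Φ dy ≤ k ∫_{Φ A} G dV_g ≤ c₂ ∫_A G∘Φ dy`
(partition `A` into countably many measurable pieces on which `Φ` is injective; on `Φ A` the number of
pieces whose image contains a point is the fibre cardinality `k`). [cite: Federer1969, §3.2.3] -/
def MultiplicityLintegral : Prop :=
    ∀ (M : Type) [TopologicalSpace M] [T2Space M] [SecondCountableTopology M]
      [ChartedSpace (EuclideanSpace ℝ (Fin 4)) M] [IsManifold (𝓡 4) ∞ M]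
      [T3Space M] [MeasurableSpace M] [BorelSpace M]
      (g : PseudoRiemannianMetric (𝓡 4) ∞ (EuclideanSpace ℝ (Fin 4)) (TangentSpace (𝓡 4) : M → Type _))
      (_hg : g.IsRiemannian) (Φ : EuclideanSpace ℝ (Fin 4) → M) (A : Set (EuclideanSpace ℝ (Fin 4)))
      (k : ℕ) (c₁ c₂ : ℝ≥0∞), 1 ≤ k → IsOpen A → ContMDiffOn (𝓡 4) (𝓡 4) ∞ Φ A →
      (∀ y ∈ A, ∃ U : Set (EuclideanSpace ℝ (Fin 4)), IsOpen U ∧ y ∈ U ∧ U ⊆ A ∧ Set.InjOn Φ U) →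
      IsOpen (Φ '' A) →
      (∀ y ∈ A, (Φ ⁻¹' {Φ y} ∩ A).ncard = k) →
      (∀ U ⊆ A, IsOpen U → Set.InjOn Φ U → ∀ S ⊆ U, MeasurableSet S →
        c₁ * volume S ≤ g.riemVolume (Φ '' S) ∧ g.riemVolume (Φ '' S) ≤ c₂ * volume S) →
      ∀ G : M → ℝ≥0∞, Measurable G →
        c₁ * ∫⁻ y in A, G (Φ y) ∂volume ≤ (k : ℝ≥0∞) * ∫⁻ x in Φ '' A, G x ∂g.riemVolume ∧
        (k : ℝ≥0∞) * ∫⁻ x in Φ '' A, G x ∂g.riemVolume ≤ c₂ * ∫⁻ y in A, G (Φ y) ∂volume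

/-- **Stub 5** — constant-multiplicity integral comparison, OPEN (fact-free). [cite: Federer1969, §3.2.3] -/
theorem stub_multiplicityLintegral :
    ∀ (M : Type) [TopologicalSpace M] [T2Space M] [SecondCountableTopology M]
      [ChartedSpace (EuclideanSpace ℝ (Fin 4)) M] [IsManifold (𝓡 4) ∞ M]
      [T3Space M] [MeasurableSpace M] [BorelSpace M]
      (g : PseudoRiemannianMetric (𝓡 4) ∞ (EuclideanSpace ℝ (Fin 4)) (TangentSpace (𝓡 4) : M → Type _))
      (_hg : g.IsRiemannian) (Φ : EuclideanSpace ℝ (Fin 4) → M) (A : Set (EuclideanSpace ℝ (Fin 4)))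
      (k : ℕ) (c₁ c₂ : ℝ≥0∞), 1 ≤ k → IsOpen A → ContMDiffOn (𝓡 4) (𝓡 4) ∞ Φ A →
      (∀ y ∈ A, ∃ U : Set (EuclideanSpace ℝ (Fin 4)), IsOpen U ∧ y ∈ U ∧ U ⊆ A ∧ Set.InjOn Φ U) →
      IsOpen (Φ '' A) →
      (∀ y ∈ A, (Φ ⁻¹' {Φ y} ∩ A).ncard = k) →
      (∀ U ⊆ A, IsOpen U → Set.InjOn Φ U → ∀ S ⊆ U, MeasurableSet S →
        c₁ * volume S ≤ g.riemVolume (Φ '' S) ∧ g.riemVolume (Φ '' S) ≤ c₂ * volume S) →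
      ∀ G : M → ℝ≥0∞, Measurable G →
        c₁ * ∫⁻ y in A, G (Φ y) ∂volume ≤ (k : ℝ≥0∞) * ∫⁻ x in Φ '' A, G x ∂g.riemVolume ∧
        (k : ℝ≥0∞) * ∫⁻ x in Φ '' A, G x ∂g.riemVolume ≤ c₂ * ∫⁻ y in A, G (Φ y) ∂volume :=
  _root_.Summit.SmoothPoincare4.SmoothPoincare4.Theorems.SubcylindricalRecognition.AncientSphereRigidity.stub_multiplicityLintegral

/-- **Statement of Stub 6** — the Gaussian annulus arithmetic in `ℝ⁴` (the localised form of
`μ(ℝ⁴/Γ) = -log |Γ|`): with the profile `w(s) = e^{-s/8τ} cut(s)`,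
`cut(s) = T(s/(2ε²) - 1) · T(3 - 4s/r'²)` (`T` = `Real.smoothTransition`; support in `[2ε², 3r'²/4]`, `= 1` on
`[4ε², r'²/2]`), and `I₀ = ∫_A w(|y|²)² dy`, `I₁ = ∫_A 16|y|² w'(|y|²)²/(1-η) dy`, `I₂ = ∫_A -w² log w² (|y|²) dy`
over the annulus `A = {ε < |y| < r'}`, any reals `J₀, J₁, J₂` with `(1-η)² I₀ ≤ k J₀ ≤ (1+η)² I₀`,
`0 ≤ k J₁ ≤ (1+η)² I₁`, `0 ≤ k J₂ ≤ (1+η)² I₂` satisfy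
`τΛ + (τ J₁ + J₂)/J₀ + log J₀ - 2 log(4πτ) - 4 < m` as soon as `m > -log k` and `η, Λτ, ε²/τ, τ/r'²` are
below thresholds depending only on `k, m` (main terms: `∫ e^{-|y|²/4τ} = 16π²τ²`,
`∫ (|y|²/4τ) e^{-|y|²/4τ} = 2 · 16π²τ²`). [folklore] -/
def ConeAnnulusArithmetic : Prop :=
    ∀ (k : ℕ), 1 ≤ k → ∀ m : ℝ, -Real.log k < m →
      ∃ η₀ : ℝ, 0 < η₀ ∧ ∃ c : ℝ, 0 < c ∧
        ∀ (η τ Λ ε r' : ℝ), 0 ≤ η → η ≤ η₀ → 0 < τ → 0 ≤ Λ → Λ * τ ≤ c →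
          0 < ε → ε ^ 2 ≤ c * τ → 0 < r' → τ ≤ c * r' ^ 2 →
          ∀ (J₀ J₁ J₂ : ℝ),
            (1 - η) ^ 2 *
                (∫ y in (Metric.ball (0 : EuclideanSpace ℝ (Fin 4)) r' \ Metric.closedBall 0 ε),
                  (Real.exp (-‖y‖ ^ 2 / (8 * τ)) *
                    (Real.smoothTransition (‖y‖ ^ 2 / (2 * ε ^ 2) - 1) *
                      Real.smoothTransition (3 - 4 * ‖y‖ ^ 2 / r' ^ 2))) ^ 2 ∂volume) ≤ k * J₀ →
            k * J₀ ≤ (1 + η) ^ 2 *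
                (∫ y in (Metric.ball (0 : EuclideanSpace ℝ (Fin 4)) r' \ Metric.closedBall 0 ε),
                  (Real.exp (-‖y‖ ^ 2 / (8 * τ)) *
                    (Real.smoothTransition (‖y‖ ^ 2 / (2 * ε ^ 2) - 1) *
                      Real.smoothTransition (3 - 4 * ‖y‖ ^ 2 / r' ^ 2))) ^ 2 ∂volume) →
            0 ≤ J₁ →
            k * J₁ ≤ (1 + η) ^ 2 *
                (∫ y in (Metric.ball (0 : EuclideanSpace ℝ (Fin 4)) r' \ Metric.closedBall 0 ε),
                  16 * ‖y‖ ^ 2 *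
                    (deriv (fun s : ℝ ↦ Real.exp (-s / (8 * τ)) *
                      (Real.smoothTransition (s / (2 * ε ^ 2) - 1) *
                        Real.smoothTransition (3 - 4 * s / r' ^ 2))) (‖y‖ ^ 2)) ^ 2 / (1 - η) ∂volume) →
            0 ≤ J₂ →
            k * J₂ ≤ (1 + η) ^ 2 *
                (∫ y in (Metric.ball (0 : EuclideanSpace ℝ (Fin 4)) r' \ Metric.closedBall 0 ε),
                  -((Real.exp (-‖y‖ ^ 2 / (8 * τ)) *
                      (Real.smoothTransition (‖y‖ ^ 2 / (2 * ε ^ 2) - 1) *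
                        Real.smoothTransition (3 - 4 * ‖y‖ ^ 2 / r' ^ 2))) ^ 2 *
                    Real.log ((Real.exp (-‖y‖ ^ 2 / (8 * τ)) *
                      (Real.smoothTransition (‖y‖ ^ 2 / (2 * ε ^ 2) - 1) *
                        Real.smoothTransition (3 - 4 * ‖y‖ ^ 2 / r' ^ 2))) ^ 2)) ∂volume) →
            τ * Λ + (τ * J₁ + J₂) / J₀ + Real.log J₀ - 2 * Real.log (4 * Real.pi * τ) - 4 < m

/-- **Stub 6** — Gaussian annulus arithmetic, OPEN (fact-free). [folklore] -/
theorem stub_coneAnnulusArithmetic :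
    ∀ (k : ℕ), 1 ≤ k → ∀ m : ℝ, -Real.log k < m →
      ∃ η₀ : ℝ, 0 < η₀ ∧ ∃ c : ℝ, 0 < c ∧
        ∀ (η τ Λ ε r' : ℝ), 0 ≤ η → η ≤ η₀ → 0 < τ → 0 ≤ Λ → Λ * τ ≤ c →
          0 < ε → ε ^ 2 ≤ c * τ → 0 < r' → τ ≤ c * r' ^ 2 →
          ∀ (J₀ J₁ J₂ : ℝ),
            (1 - η) ^ 2 *
                (∫ y in (Metric.ball (0 : EuclideanSpace ℝ (Fin 4)) r' \ Metric.closedBall 0 ε),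
                  (Real.exp (-‖y‖ ^ 2 / (8 * τ)) *
                    (Real.smoothTransition (‖y‖ ^ 2 / (2 * ε ^ 2) - 1) *
                      Real.smoothTransition (3 - 4 * ‖y‖ ^ 2 / r' ^ 2))) ^ 2 ∂volume) ≤ k * J₀ →
            k * J₀ ≤ (1 + η) ^ 2 *
                (∫ y in (Metric.ball (0 : EuclideanSpace ℝ (Fin 4)) r' \ Metric.closedBall 0 ε),
                  (Real.exp (-‖y‖ ^ 2 / (8 * τ)) *
                    (Real.smoothTransition (‖y‖ ^ 2 / (2 * ε ^ 2) - 1) *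
                      Real.smoothTransition (3 - 4 * ‖y‖ ^ 2 / r' ^ 2))) ^ 2 ∂volume) →
            0 ≤ J₁ →
            k * J₁ ≤ (1 + η) ^ 2 *
                (∫ y in (Metric.ball (0 : EuclideanSpace ℝ (Fin 4)) r' \ Metric.closedBall 0 ε),
                  16 * ‖y‖ ^ 2 *
                    (deriv (fun s : ℝ ↦ Real.exp (-s / (8 * τ)) *
                      (Real.smoothTransition (s / (2 * ε ^ 2) - 1) *
                        Real.smoothTransition (3 - 4 * s / r' ^ 2))) (‖y‖ ^ 2)) ^ 2 / (1 - η) ∂volume) →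
            0 ≤ J₂ →
            k * J₂ ≤ (1 + η) ^ 2 *
                (∫ y in (Metric.ball (0 : EuclideanSpace ℝ (Fin 4)) r' \ Metric.closedBall 0 ε),
                  -((Real.exp (-‖y‖ ^ 2 / (8 * τ)) *
                      (Real.smoothTransition (‖y‖ ^ 2 / (2 * ε ^ 2) - 1) *
                        Real.smoothTransition (3 - 4 * ‖y‖ ^ 2 / r' ^ 2))) ^ 2 *
                    Real.log ((Real.exp (-‖y‖ ^ 2 / (8 * τ)) *
                      (Real.smoothTransition (‖y‖ ^ 2 / (2 * ε ^ 2) - 1) *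
                        Real.smoothTransition (3 - 4 * ‖y‖ ^ 2 / r' ^ 2))) ^ 2)) ∂volume) →
            τ * Λ + (τ * J₁ + J₂) / J₀ + Real.log J₀ - 2 * Real.log (4 * Real.pi * τ) - 4 < m := by
  sorry

/-! ## Stub 7 (r5) — the assembly (lead): r4's `stub_blowdownSoliton` from Stubs 2–6 -/

/-- **r4's `stub_blowdownSoliton`, verbatim, as a proposition**: complete smooth connected shrinker in
Bamler's normalisation with `W ≥ ν_cyl + δ'`, `R > 0`, `∫ e^{-f} = 16π²`, compact ⇒ injective immersion.
[cite: Bamler2020Structure, Thm 15, 29, 35] -/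
def BlowdownSolitonStatement : Prop :=
    ∀ (M : Type) [TopologicalSpace M] [T2Space M] [SecondCountableTopology M]
      [ChartedSpace (EuclideanSpace ℝ (Fin 4)) M] [IsManifold (𝓡 4) ∞ M] [CompactSpace M]
      [ConnectedSpace M] [T3Space M] [MeasurableSpace M] [BorelSpace M]
      (A : ℕ → ℝ)
      (gk : ℕ → ℝ → PseudoRiemannianMetric (𝓡 4) ∞ (EuclideanSpace ℝ (Fin 4)) (TangentSpace (𝓡 4) : M → Type _))
      (covk : ℕ → ℝ → CovariantDerivative (𝓡 4) (EuclideanSpace ℝ (Fin 4)) (TangentSpace (𝓡 4) : M → Type _))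
      (xk : ℕ → M) (δ' c : ℝ), 0 < δ' → 0 < c →
      (∀ k : ℕ, (k : ℝ) ≤ A k) →
      (∀ k, IsRicciFlow (gk k) (covk k) (Set.Icc (-(A k)) 0)) →
      (∀ k, ∀ t ∈ Set.Icc (-(A k)) 0, (gk k t).IsRiemannian) →
      (∀ k, ∀ t ∈ Set.Icc (-(A k)) 0, CurvatureBoundedBy (gk k t) (covk k t) 1) →
      (∀ k, ∃ X Y Z W : TangentSpace (𝓡 4) (xk k),
        (gk k 0).val (xk k) X X ≤ 1 ∧ (gk k 0).val (xk k) Y Y ≤ 1 ∧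
        (gk k 0).val (xk k) Z Z ≤ 1 ∧ (gk k 0).val (xk k) W W ≤ 1 ∧
        c ≤ |(gk k 0).curvatureForm (covk k 0) (xk k) X Y Z W|) →
      (∀ k, ∀ t ∈ Set.Icc (-(A k)) 0, ∀ τ : ℝ, 0 < τ →
        ((Real.log 2 + Real.log Real.pi / 2 - 3 / 2 + δ' : ℝ) : EReal) ≤
          (gk k t).muEntropy (covk k t) τ) →
      ∃ (S : Type) (_ : TopologicalSpace S) (_ : T2Space S) (_ : SecondCountableTopology S)
        (_ : ChartedSpace (EuclideanSpace ℝ (Fin 4)) S) (_ : IsManifold (𝓡 4) ∞ S) (_ : ConnectedSpace S)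
        (_ : T3Space S) (_ : MeasurableSpace S) (_ : BorelSpace S)
        (gS : PseudoRiemannianMetric (𝓡 4) ∞ (EuclideanSpace ℝ (Fin 4)) (TangentSpace (𝓡 4) : S → Type _))
        (_ : gS.HasLeviCivita) (f : S → ℝ) (hS : gS.IsRiemannian) (W : ℝ),
        (∀ (x : S) (r : NNReal), IsCompact {y : S | gS.edist hS x y ≤ r}) ∧
        ContMDiff (𝓡 4) 𝓘(ℝ, ℝ) ∞ f ∧
        (∀ (x : S) (X Y : TangentSpace (𝓡 4) x),
          gS.ricci x X Y + gS.hessian f x X Y = (1 / 2 : ℝ) * gS.val x X Y) ∧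
        (∀ x : S, gS.scalarCurvature x + gS.gradSq f x = f x - W) ∧
        ∫⁻ x, ENNReal.ofReal (Real.exp (-f x))
            ∂(riemannianMeasure (gS.toContMDiffRiemannianMetric hS)) =
          ENNReal.ofReal (16 * Real.pi ^ 2) ∧
        Real.log 2 + Real.log Real.pi / 2 - 3 / 2 + δ' ≤ W ∧
        (∀ x : S, 0 < gS.scalarCurvature x) ∧
        (CompactSpace S → ∃ φ : S → M, ContMDiff (𝓡 4) (𝓡 4) ∞ φ ∧ Function.Injective φ ∧
          ∀ x : S, Function.Injective (mfderiv (𝓡 4) (𝓡 4) φ x))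

/-! ## Helpers (lead glue) -/

section Helpers

/-- `-log k < ν_cyl + δ'` for `k ≥ 2`, `δ' > 0`: `-log k ≤ -log 2` and `2 log 2 + (log π)/2 > 3/2`
(`log 2 > 0.693`, `log π > 1` since `π > 3 > e`). [folklore] -/
theorem neg_log_lt_nuCyl_add {k : ℕ} (hk : 2 ≤ k) {δ' : ℝ} (hδ' : 0 < δ') :
    -Real.log k < Real.log 2 + Real.log Real.pi / 2 - 3 / 2 + δ' := by
  have hk' : (2 : ℝ) ≤ k := by exact_mod_cast hk
  have hlogk : Real.log 2 ≤ Real.log k := Real.log_le_log (by norm_num) hk'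
  have h2 : (0.6931471803 : ℝ) < Real.log 2 := Real.log_two_gt_d9
  have hpi : 1 < Real.log Real.pi := by
    rw [← Real.log_exp 1]
    refine Real.log_lt_log (Real.exp_pos 1) ?_
    have := Real.exp_one_lt_d9
    have := Real.pi_gt_three
    linarith
  linarith

variable {M : Type*} [TopologicalSpace M] [ChartedSpace (EuclideanSpace ℝ (Fin 4)) M]

/-- Zero extension: a function smooth on an open `V`, vanishing off a closed `K ⊆ V`, is smooth. [folklore] -/
theorem contMDiff_of_contMDiffOn_of_eq_zero {F : M → ℝ} {V K : Set M} (hV : IsOpen V)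
    (hK : IsClosed K) (hKV : K ⊆ V) (hF : ContMDiffOn (𝓡 4) 𝓘(ℝ, ℝ) ∞ F V)
    (h0 : ∀ x ∉ K, F x = 0) : ContMDiff (𝓡 4) 𝓘(ℝ, ℝ) ∞ F := by
  intro x
  by_cases hx : x ∈ K
  · exact (hF x (hKV hx)).contMDiffAt (hV.mem_nhds (hKV hx))
  · have hev : F =ᶠ[𝓝 x] fun _ ↦ (0 : ℝ) := by
      filter_upwards [hK.isOpen_compl.mem_nhds hx] with y hy using h0 y hy
    exact contMDiffAt_const.congr_of_eventuallyEq hev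

omit [ChartedSpace (EuclideanSpace ℝ (Fin 4)) M] in
/-- Zero extension, continuous version. [folklore] -/
theorem continuous_of_continuousOn_of_eq_zero {F : M → ℝ} {V K : Set M} (hV : IsOpen V)
    (hK : IsClosed K) (hKV : K ⊆ V) (hF : ContinuousOn F V)
    (h0 : ∀ x ∉ K, F x = 0) : Continuous F := by
  rw [continuous_iff_continuousAt]
  intro x
  by_cases hx : x ∈ K
  · exact (hF x (hKV hx)).continuousAt (hV.mem_nhds (hKV hx))
  · have hev : F =ᶠ[𝓝 x] fun _ ↦ (0 : ℝ) := by
      filter_upwards [hK.isOpen_compl.mem_nhds hx] with y hy using h0 y hy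
    exact (continuousAt_const.congr hev.symm)

/-- A bilinear-form-valued map continuous on a ball and Euclidean at the centre is `(1±θ)`-close to
the Euclidean square norm on a smaller ball. [folklore] -/
theorem exists_ball_sq_norm_comparison
    {G : EuclideanSpace ℝ (Fin 4) →
      (EuclideanSpace ℝ (Fin 4) →L[ℝ] EuclideanSpace ℝ (Fin 4) →L[ℝ] ℝ)}
    {r θ : ℝ} (hr : 0 < r) (hθ : 0 < θ) (hG : ContinuousOn G (Metric.ball 0 r))
    (hG0 : ∀ v w, G 0 v w = inner ℝ v w) :
    ∃ r₁ : ℝ, 0 < r₁ ∧ r₁ < r ∧ ∀ y ∈ Metric.ball (0 : EuclideanSpace ℝ (Fin 4)) r₁,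
      ∀ v : EuclideanSpace ℝ (Fin 4),
        (1 - θ) * ‖v‖ ^ 2 ≤ G y v v ∧ G y v v ≤ (1 + θ) * ‖v‖ ^ 2 := by
  have h0 : (0 : EuclideanSpace ℝ (Fin 4)) ∈ Metric.ball 0 r := Metric.mem_ball_self hr
  have hc : ContinuousAt G 0 := (hG 0 h0).continuousAt (Metric.isOpen_ball.mem_nhds h0)
  obtain ⟨δ, hδ, hδG⟩ := (@NormedAddCommGroup.tendsto_nhds_nhds _ _ _ _ G 0 (G 0)).mp hc θ hθ
  refine ⟨min δ r / 2, by positivity, by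
    have := min_le_right δ r; linarith, fun y hy v ↦ ?_⟩
  have hyδ : ‖y - 0‖ < δ := by
    have := min_le_left δ r
    rw [Metric.mem_ball, dist_eq_norm] at hy
    linarith
  have hGG : ‖G y - G 0‖ < θ := hδG y hyδ
  have hvv : G 0 v v = ‖v‖ ^ 2 := by rw [hG0, real_inner_self_eq_norm_sq]
  have hdiff : |G y v v - ‖v‖ ^ 2| ≤ θ * ‖v‖ ^ 2 := by
    have h1 : G y v v - ‖v‖ ^ 2 = (G y - G 0) v v := by
      rw [← hvv]; simp only [sub_apply]
    rw [h1]
    calc |(G y - G 0) v v| = ‖(G y - G 0) v v‖ := (Real.norm_eq_abs _).symm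
      _ ≤ ‖(G y - G 0) v‖ * ‖v‖ := ContinuousLinearMap.le_opNorm _ _
      _ ≤ ‖G y - G 0‖ * ‖v‖ * ‖v‖ := by
          gcongr; exact ContinuousLinearMap.le_opNorm _ _
      _ ≤ θ * ‖v‖ * ‖v‖ := by gcongr
      _ = θ * ‖v‖ ^ 2 := by ring
  constructor <;> nlinarith [abs_le.mp hdiff]

end Helpers

section GradSq

variable {M : Type*} [TopologicalSpace M] [ChartedSpace (EuclideanSpace ℝ (Fin 4)) M]
  [IsManifold (𝓡 4) ∞ M]

/-- **Gradient of the descended radius-squared under an almost isometry.** If `Φ` is a local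
diffeomorphism of an open `A ⊆ ℝ⁴` into `M` with `h(dΦ v, dΦ v) ≥ (1-η)|v|²` at `y` and `ρ ∘ Φ = |·|²`
on `A`, then `|∇ρ|²_h (Φ y) ≤ 4|y|²/(1-η)`. [folklore] -/
theorem gradSq_descent_le
    (h : PseudoRiemannianMetric (𝓡 4) ∞ (EuclideanSpace ℝ (Fin 4)) (TangentSpace (𝓡 4) : M → Type _))
    {Φ : EuclideanSpace ℝ (Fin 4) → M} {ρ : M → ℝ} {A : Set (EuclideanSpace ℝ (Fin 4))}
    {V : Set M} {η : ℝ} (hη : η < 1) (hA : IsOpen A) (hV : IsOpen V)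
    (hΦ : ContMDiffOn (𝓡 4) (𝓡 4) ∞ Φ A) (hρ : ContMDiffOn (𝓡 4) 𝓘(ℝ, ℝ) ∞ ρ V)
    (hAV : Set.MapsTo Φ A V) (hdesc : ∀ y ∈ A, ρ (Φ y) = ‖y‖ ^ 2)
    {y : EuclideanSpace ℝ (Fin 4)} (hy : y ∈ A)
    (hinj : Function.Injective (mfderiv (𝓡 4) (𝓡 4) Φ y))
    (hcomp : ∀ v : EuclideanSpace ℝ (Fin 4),
      (1 - η) * ‖v‖ ^ 2 ≤ h.val (Φ y) (mfderiv (𝓡 4) (𝓡 4) Φ y v) (mfderiv (𝓡 4) (𝓡 4) Φ y v)) :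
    h.gradSq ρ (Φ y) ≤ 4 * ‖y‖ ^ 2 / (1 - η) := by
  haveI hfd1 : FiniteDimensional ℝ (TangentSpace (𝓡 4) y) :=
    inferInstanceAs (FiniteDimensional ℝ (EuclideanSpace ℝ (Fin 4)))
  set x := Φ y with hx
  haveI hfd2 : FiniteDimensional ℝ (TangentSpace (𝓡 4) x) :=
    inferInstanceAs (FiniteDimensional ℝ (EuclideanSpace ℝ (Fin 4)))
  have hΦy : MDifferentiableAt (𝓡 4) (𝓡 4) Φ y :=
    ((hΦ y hy).contMDiffAt (hA.mem_nhds hy)).mdifferentiableAt (by simp)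
  have hρx : MDifferentiableAt (𝓡 4) 𝓘(ℝ, ℝ) ρ x :=
    ((hρ x (hAV hy)).contMDiffAt (hV.mem_nhds (hAV hy))).mdifferentiableAt (by simp)
  -- the differential of `ρ` at `x`, as a linear functional, and its metric dual `u = ♯dρ`
  set α : TangentSpace (𝓡 4) x →ₗ[ℝ] ℝ :=
    (mvfderiv (𝓡 4) ρ x : TangentSpace (𝓡 4) x →ₗ[ℝ] ℝ) with hα
  set u : TangentSpace (𝓡 4) x := h.sharp x α with hu
  have hgrad : h.gradSq ρ x = α u := rfl
  have hval : ∀ w, h.val x u w = α w := fun w ↦ h.val_sharp_apply x α w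
  have hαapp : ∀ w, α w = mfderiv (𝓡 4) 𝓘(ℝ, ℝ) ρ x w := fun w ↦ rfl
  -- `dΦ_y` is a linear bijection `ℝ⁴ → T_x M = ℝ⁴`
  set D : TangentSpace (𝓡 4) y →ₗ[ℝ] TangentSpace (𝓡 4) x :=
    ((mfderiv (𝓡 4) (𝓡 4) Φ y : TangentSpace (𝓡 4) y →L[ℝ] TangentSpace (𝓡 4) x) :
      TangentSpace (𝓡 4) y →ₗ[ℝ] TangentSpace (𝓡 4) x) with hD
  have hDinj : Function.Injective D := hinj
  have hDsurj : Function.Surjective D :=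
    (LinearMap.injective_iff_surjective_of_finrank_eq_finrank rfl).mp hDinj
  obtain ⟨v, hDv⟩ : ∃ v : EuclideanSpace ℝ (Fin 4), mfderiv (𝓡 4) (𝓡 4) Φ y v = u := hDsurj u
  -- chain rule: `dρ_x (dΦ_y v) = d(|·|²)_y v = 2⟪y, v⟫`
  have hchain : α u = 2 * inner ℝ y v := by
    have hcompd : mfderiv (𝓡 4) 𝓘(ℝ, ℝ) (ρ ∘ Φ) y =
        (mfderiv (𝓡 4) 𝓘(ℝ, ℝ) ρ x).comp (mfderiv (𝓡 4) (𝓡 4) Φ y) := mfderiv_comp y hρx hΦy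
    have hev : (ρ ∘ Φ) =ᶠ[𝓝 y] fun z : EuclideanSpace ℝ (Fin 4) ↦ ‖z‖ ^ 2 := by
      filter_upwards [hA.mem_nhds hy] with z hz using hdesc z hz
    have hsq : mfderiv (𝓡 4) 𝓘(ℝ, ℝ) (ρ ∘ Φ) y =
        mfderiv 𝓘(ℝ, EuclideanSpace ℝ (Fin 4)) 𝓘(ℝ, ℝ) (fun z : EuclideanSpace ℝ (Fin 4) ↦ ‖z‖ ^ 2) y :=
      hev.mfderiv_eq
    have hflat : (mfderiv 𝓘(ℝ, EuclideanSpace ℝ (Fin 4)) 𝓘(ℝ, ℝ)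
        (fun z : EuclideanSpace ℝ (Fin 4) ↦ ‖z‖ ^ 2) y v : ℝ) = 2 * inner ℝ y v := by
      rw [mfderiv_eq_fderiv, fderiv_norm_sq_apply]
      simp only [two_smul]
      change innerSL ℝ y v + innerSL ℝ y v = 2 * inner ℝ y v
      rw [innerSL_apply_apply, two_mul]
    have e1 : (α u : ℝ) = (mfderiv (𝓡 4) 𝓘(ℝ, ℝ) (ρ ∘ Φ) y v : ℝ) := by
      rw [hαapp, ← hDv, hcompd]; rfl
    have e2 : (mfderiv (𝓡 4) 𝓘(ℝ, ℝ) (ρ ∘ Φ) y v : ℝ) =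
        (mfderiv 𝓘(ℝ, EuclideanSpace ℝ (Fin 4)) 𝓘(ℝ, ℝ)
          (fun z : EuclideanSpace ℝ (Fin 4) ↦ ‖z‖ ^ 2) y v : ℝ) := by
      rw [hsq]; rfl
    exact e1.trans (e2.trans hflat)
  -- the two estimates
  have hlow : (1 - η) * ‖v‖ ^ 2 ≤ α u := by
    have := hcomp v
    rwa [hDv, hval] at this
  have hup : α u ≤ 2 * (‖y‖ * ‖v‖) := by
    rw [hchain]
    have := real_inner_le_norm y v
    linarith
  rw [hgrad]
  have h1η : 0 < 1 - η := by linarith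
  rw [le_div_iff₀ h1η]
  -- `G ≥ 0`, `G ≤ 2|y||v|`, `(1-η)|v|² ≤ G` ⇒ `G (1-η) ≤ 4|y|²`
  have hG0 : 0 ≤ α u := le_trans (by positivity) hlow
  by_cases hG : α u = 0
  · rw [hG, zero_mul]; positivity
  · have hGpos : 0 < α u := lt_of_le_of_ne hG0 (Ne.symm hG)
    -- `G² ≤ 4|y|²|v|² ≤ 4|y|² G/(1-η)`
    have hsq : α u * α u ≤ 4 * ‖y‖ ^ 2 * ‖v‖ ^ 2 := by
      have h2 : 0 ≤ 2 * (‖y‖ * ‖v‖) := by positivity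
      nlinarith [hup, hG0]
    have h3 : 4 * ‖y‖ ^ 2 * ‖v‖ ^ 2 * (1 - η) ≤ 4 * ‖y‖ ^ 2 * α u := by
      have := mul_le_mul_of_nonneg_left hlow (by positivity : (0 : ℝ) ≤ 4 * ‖y‖ ^ 2)
      linarith
    nlinarith [hsq, h3, hGpos]

end GradSq

section Profile

/-- **The radial profile** `W(s) = e^{-s/8τ} · T(s/(2ε²) - 1) · T(3 - 4s/r'²)`: smooth, with values in
`[0, 1]`, vanishing for `s ≤ 2ε²` and for `s ≥ 3r'²/4`, hence with vanishing derivative on the open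
flat zones `s < 2ε²`, `s > 3r'²/4`. [folklore] -/
theorem profile_props {τ ε r' : ℝ} (hτ : 0 < τ) (hε : 0 < ε) (hr' : 0 < r') (W : ℝ → ℝ)
    (hW : W = fun s : ℝ ↦ Real.exp (-s / (8 * τ)) *
        (Real.smoothTransition (s / (2 * ε ^ 2) - 1) * Real.smoothTransition (3 - 4 * s / r' ^ 2))) :
    ContDiff ℝ ∞ W ∧ (∀ s, 0 ≤ W s) ∧ (∀ s, 0 ≤ s → W s ≤ 1) ∧
    (∀ s, s < 2 * ε ^ 2 ∨ 3 * r' ^ 2 / 4 < s → W s = 0 ∧ deriv W s = 0) ∧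
    (∀ s, 2 * ε ^ 2 < s → s < 3 * r' ^ 2 / 4 → 0 < W s) := by
  have hsmooth : ContDiff ℝ ∞ W := by
    rw [hW]
    apply ContDiff.mul
    · exact Real.contDiff_exp.comp (by fun_prop)
    · exact (Real.smoothTransition.contDiff.comp (by fun_prop)).mul
        (Real.smoothTransition.contDiff.comp (by fun_prop))
  -- zero set: closed flat zones
  have hzero : ∀ s, s ≤ 2 * ε ^ 2 ∨ 3 * r' ^ 2 / 4 ≤ s → W s = 0 := by
    intro s hs
    rw [hW]
    rcases hs with hs | hs
    · have h1 : Real.smoothTransition (s / (2 * ε ^ 2) - 1) = 0 := by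
        apply Real.smoothTransition.zero_of_nonpos
        rw [sub_nonpos, div_le_one (by positivity)]
        exact hs
      simp only [h1, zero_mul, mul_zero]
    · have h1 : Real.smoothTransition (3 - 4 * s / r' ^ 2) = 0 := by
        apply Real.smoothTransition.zero_of_nonpos
        rw [sub_nonpos, le_div_iff₀ (by positivity)]
        linarith only [hs]
      simp only [h1, mul_zero]
  refine ⟨hsmooth, fun s ↦ ?_, fun s hs ↦ ?_, fun s hs ↦ ?_, fun s hs1 hs2 ↦ ?_⟩
  · rw [hW]
    exact mul_nonneg (Real.exp_nonneg _) (mul_nonneg (Real.smoothTransition.nonneg _)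
      (Real.smoothTransition.nonneg _))
  · have h1 : Real.exp (-s / (8 * τ)) ≤ 1 := by
      rw [Real.exp_le_one_iff, neg_div]; exact neg_nonpos.mpr (by positivity)
    have h2 : Real.smoothTransition (s / (2 * ε ^ 2) - 1) ≤ 1 := Real.smoothTransition.le_one _
    have h3 : Real.smoothTransition (3 - 4 * s / r' ^ 2) ≤ 1 := Real.smoothTransition.le_one _
    have h2' := Real.smoothTransition.nonneg (s / (2 * ε ^ 2) - 1)
    have h3' := Real.smoothTransition.nonneg (3 - 4 * s / r' ^ 2)
    rw [hW]
    calc Real.exp (-s / (8 * τ)) *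
          (Real.smoothTransition (s / (2 * ε ^ 2) - 1) * Real.smoothTransition (3 - 4 * s / r' ^ 2))
        ≤ 1 * (1 * 1) := by gcongr
      _ = 1 := by ring
  · -- open flat zones: `W` vanishes near `s`, so does its derivative
    have hev : W =ᶠ[𝓝 s] fun _ ↦ (0 : ℝ) := by
      rcases hs with hs | hs
      · filter_upwards [Iio_mem_nhds hs] with t ht using hzero t (Or.inl (le_of_lt ht))
      · filter_upwards [Ioi_mem_nhds hs] with t ht using hzero t (Or.inr (le_of_lt ht))
    exact ⟨hzero s (hs.imp le_of_lt le_of_lt), by rw [hev.deriv_eq]; simp⟩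
  · rw [hW]
    refine mul_pos (Real.exp_pos _) (mul_pos ?_ ?_)
    · apply Real.smoothTransition.pos_of_pos
      rw [sub_pos, one_lt_div (by positivity)]; exact hs1
    · apply Real.smoothTransition.pos_of_pos
      rw [sub_pos, div_lt_iff₀ (by positivity)]; linarith only [hs2]

end Profile

section ConeCore

/-- **Cone exclusion on a closed Riemannian 4-manifold (core).** If a closed Riemannian 4-manifold
`(M, h)` contains the `(1±η)`-almost-isometric `k`-to-`1` image `Φ(A)` of the Euclidean annulus
`A = {ε < |y| < r'}` with the descent `ρ` of `|y|²`, scalar curvature `|R_h| ≤ Λ` on `Φ(A)`, and the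
parameters are below the thresholds of the annulus arithmetic (hypothesis `harith` = the conclusion of
`stub_coneAnnulusArithmetic` at these parameters), then `μ(h, τ) < m`; in particular an entropy floor
`m ≤ μ(h, τ)` is contradictory. Test function `w = 𝟙_{Φ A} · W(ρ)` with the radial profile `W` of
`profile_props`; `stub_muEntropyTestFunction` bounds `μ`, `stub_injOnVolumeComparison` +
`stub_multiplicityLintegral` transplant the three integrals to `A`. [folklore] -/
theorem coneCore (hS3 : MuEntropyTestFunctionBound) (hS4 : InjOnVolumeComparison)
    (hS5 : MultiplicityLintegral)
    (M : Type) [TopologicalSpace M] [T2Space M] [SecondCountableTopology M]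
    [ChartedSpace (EuclideanSpace ℝ (Fin 4)) M] [IsManifold (𝓡 4) ∞ M] [CompactSpace M]
    [T3Space M] [MeasurableSpace M] [BorelSpace M]
    (h : PseudoRiemannianMetric (𝓡 4) ∞ (EuclideanSpace ℝ (Fin 4)) (TangentSpace (𝓡 4) : M → Type _))
    (hh : h.IsRiemannian)
    (cov : CovariantDerivative (𝓡 4) (EuclideanSpace ℝ (Fin 4)) (TangentSpace (𝓡 4) : M → Type _))
    (hR : Continuous fun x ↦ h.scalarCurvatureWith cov x)
    (k : ℕ) (hk : 1 ≤ k) (m η τ Λ ε r' : ℝ) (hη0 : 0 ≤ η) (hη1 : η < 1) (hτ : 0 < τ)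
    (hε : 0 < ε) (hr' : 0 < r') (hεr : 8 * ε ^ 2 < 3 * r' ^ 2)
    (Φ : EuclideanSpace ℝ (Fin 4) → M) (ρ : M → ℝ)
    (hΦ : ContMDiffOn (𝓡 4) (𝓡 4) ∞ Φ (Metric.ball 0 r' \ Metric.closedBall 0 ε))
    (hopen : IsOpen (Φ '' (Metric.ball 0 r' \ Metric.closedBall 0 ε)))
    (hmf : ∀ y ∈ Metric.ball (0 : EuclideanSpace ℝ (Fin 4)) r' \ Metric.closedBall 0 ε,
      Function.Injective (mfderiv (𝓡 4) (𝓡 4) Φ y))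
    (hfib : ∀ y ∈ Metric.ball (0 : EuclideanSpace ℝ (Fin 4)) r' \ Metric.closedBall 0 ε,
      (Φ ⁻¹' {Φ y} ∩ (Metric.ball 0 r' \ Metric.closedBall 0 ε)).ncard = k)
    (hρ : ContMDiffOn (𝓡 4) 𝓘(ℝ, ℝ) ∞ ρ (Φ '' (Metric.ball 0 r' \ Metric.closedBall 0 ε)))
    (hdesc : ∀ y ∈ Metric.ball (0 : EuclideanSpace ℝ (Fin 4)) r' \ Metric.closedBall 0 ε,
      ρ (Φ y) = ‖y‖ ^ 2)
    (hcomp : ∀ y ∈ Metric.ball (0 : EuclideanSpace ℝ (Fin 4)) r' \ Metric.closedBall 0 ε,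
      ∀ v : EuclideanSpace ℝ (Fin 4),
        (1 - η) * ‖v‖ ^ 2 ≤ h.val (Φ y) (mfderiv (𝓡 4) (𝓡 4) Φ y v) (mfderiv (𝓡 4) (𝓡 4) Φ y v) ∧
        h.val (Φ y) (mfderiv (𝓡 4) (𝓡 4) Φ y v) (mfderiv (𝓡 4) (𝓡 4) Φ y v) ≤ (1 + η) * ‖v‖ ^ 2)
    (hRΛ : ∀ y ∈ Metric.ball (0 : EuclideanSpace ℝ (Fin 4)) r' \ Metric.closedBall 0 ε,
      |h.scalarCurvatureWith cov (Φ y)| ≤ Λ)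
    (harith : ∀ (J₀ J₁ J₂ : ℝ),
      (1 - η) ^ 2 *
          (∫ y in (Metric.ball (0 : EuclideanSpace ℝ (Fin 4)) r' \ Metric.closedBall 0 ε),
            (Real.exp (-‖y‖ ^ 2 / (8 * τ)) *
              (Real.smoothTransition (‖y‖ ^ 2 / (2 * ε ^ 2) - 1) *
                Real.smoothTransition (3 - 4 * ‖y‖ ^ 2 / r' ^ 2))) ^ 2 ∂volume) ≤ k * J₀ →
      k * J₀ ≤ (1 + η) ^ 2 *
          (∫ y in (Metric.ball (0 : EuclideanSpace ℝ (Fin 4)) r' \ Metric.closedBall 0 ε),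
            (Real.exp (-‖y‖ ^ 2 / (8 * τ)) *
              (Real.smoothTransition (‖y‖ ^ 2 / (2 * ε ^ 2) - 1) *
                Real.smoothTransition (3 - 4 * ‖y‖ ^ 2 / r' ^ 2))) ^ 2 ∂volume) →
      0 ≤ J₁ →
      k * J₁ ≤ (1 + η) ^ 2 *
          (∫ y in (Metric.ball (0 : EuclideanSpace ℝ (Fin 4)) r' \ Metric.closedBall 0 ε),
            16 * ‖y‖ ^ 2 *
              (deriv (fun s : ℝ ↦ Real.exp (-s / (8 * τ)) *
                (Real.smoothTransition (s / (2 * ε ^ 2) - 1) *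
                  Real.smoothTransition (3 - 4 * s / r' ^ 2))) (‖y‖ ^ 2)) ^ 2 / (1 - η) ∂volume) →
      0 ≤ J₂ →
      k * J₂ ≤ (1 + η) ^ 2 *
          (∫ y in (Metric.ball (0 : EuclideanSpace ℝ (Fin 4)) r' \ Metric.closedBall 0 ε),
            -((Real.exp (-‖y‖ ^ 2 / (8 * τ)) *
                (Real.smoothTransition (‖y‖ ^ 2 / (2 * ε ^ 2) - 1) *
                  Real.smoothTransition (3 - 4 * ‖y‖ ^ 2 / r' ^ 2))) ^ 2 *
              Real.log ((Real.exp (-‖y‖ ^ 2 / (8 * τ)) *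
                (Real.smoothTransition (‖y‖ ^ 2 / (2 * ε ^ 2) - 1) *
                  Real.smoothTransition (3 - 4 * ‖y‖ ^ 2 / r' ^ 2))) ^ 2)) ∂volume) →
      τ * Λ + (τ * J₁ + J₂) / J₀ + Real.log J₀ - 2 * Real.log (4 * Real.pi * τ) - 4 < m) :
    h.muEntropy cov τ < (m : EReal) := by
  classical
  -- ### sets (opaque abbreviations with defining equations)
  obtain ⟨A, hA⟩ : ∃ A : Set (EuclideanSpace ℝ (Fin 4)), A = Metric.ball 0 r' \ Metric.closedBall 0 ε :=
    ⟨_, rfl⟩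
  rw [← hA] at hΦ hopen hmf hfib hρ hdesc hcomp hRΛ harith
  obtain ⟨V, hV⟩ : ∃ V : Set M, V = Φ '' A := ⟨_, rfl⟩
  rw [← hV] at hopen hρ
  have hAo : IsOpen A := by rw [hA]; exact Metric.isOpen_ball.sdiff Metric.isClosed_closedBall
  have hmemA : ∀ {y : EuclideanSpace ℝ (Fin 4)}, y ∈ A ↔ ε < ‖y‖ ∧ ‖y‖ < r' := by
    intro y
    simp only [hA, Set.mem_sdiff, Metric.mem_ball, dist_zero_right, Metric.mem_closedBall, not_le]
    tauto
  obtain ⟨C, hC⟩ : ∃ C : Set (EuclideanSpace ℝ (Fin 4)),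
      C = {y | 3 * ε ^ 2 / 2 ≤ ‖y‖ ^ 2 ∧ ‖y‖ ^ 2 ≤ 7 * r' ^ 2 / 8} := ⟨_, rfl⟩
  have hmemC : ∀ {y : EuclideanSpace ℝ (Fin 4)}, y ∈ C ↔ 3 * ε ^ 2 / 2 ≤ ‖y‖ ^ 2 ∧
      ‖y‖ ^ 2 ≤ 7 * r' ^ 2 / 8 := by intro y; rw [hC]; rfl
  have hCA : C ⊆ A := by
    intro y hy
    rw [hmemC] at hy
    rw [hmemA, ← abs_of_nonneg (norm_nonneg y), ← abs_of_pos hε, ← abs_of_pos hr', ← sq_lt_sq,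
      ← sq_lt_sq]
    constructor
    · linarith only [hy.1, sq_nonneg ε, pow_pos hε 2]
    · linarith only [hy.2, pow_pos hr' 2]
  have hnsq : Continuous fun y : EuclideanSpace ℝ (Fin 4) ↦ ‖y‖ ^ 2 := by fun_prop
  have hCclosed : IsClosed C := by
    rw [hC]
    exact (isClosed_le continuous_const hnsq).inter (isClosed_le hnsq continuous_const)
  have hAsub : A ⊆ Metric.closedBall (0 : EuclideanSpace ℝ (Fin 4)) r' := by
    rw [hA]; exact Set.sdiff_subset.trans Metric.ball_subset_closedBall
  have hCcpt : IsCompact C :=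
    Metric.isCompact_of_isClosed_isBounded hCclosed (Metric.isBounded_closedBall.subset (hCA.trans hAsub))
  obtain ⟨K, hK⟩ : ∃ K : Set M, K = Φ '' C := ⟨_, rfl⟩
  have hKcpt : IsCompact K := hK ▸ hCcpt.image_of_continuousOn (hΦ.continuousOn.mono hCA)
  have hKclosed : IsClosed K := hKcpt.isClosed
  have hKV : K ⊆ V := by rw [hK, hV]; exact image_mono hCA
  have hKrep : ∀ x ∈ K, ∃ y ∈ C, Φ y = x := fun x hx ↦ (mem_image _ _ _).mp (hK ▸ hx)
  have hmemK : ∀ y ∈ C, Φ y ∈ K := fun y hy ↦ hK ▸ mem_image_of_mem Φ hy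
  -- ### the profile `W`
  obtain ⟨W, hWdef⟩ : ∃ W : ℝ → ℝ, W = fun s : ℝ ↦ Real.exp (-s / (8 * τ)) *
      (Real.smoothTransition (s / (2 * ε ^ 2) - 1) * Real.smoothTransition (3 - 4 * s / r' ^ 2)) :=
    ⟨_, rfl⟩
  obtain ⟨hWsmooth, hW0, hW1, hWflat, hWpos⟩ := profile_props hτ hε hr' W hWdef
  have hWdiff : Differentiable ℝ W := hWsmooth.differentiable (by simp)
  have hW'cont : Continuous (deriv W) := hWsmooth.continuous_deriv (by simp)
  have hW00 : W 0 = 0 := (hWflat 0 (Or.inl (by positivity))).1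
  -- off `C` (inside `A`) the profile and its derivative vanish at `|y|²`
  have hflatA : ∀ y ∈ A, y ∉ C → W (‖y‖ ^ 2) = 0 ∧ deriv W (‖y‖ ^ 2) = 0 := by
    intro y _ hyC
    apply hWflat
    rw [hmemC, not_and_or, not_le, not_le] at hyC
    rcases hyC with h1 | h1
    · left; linarith only [h1, pow_pos hε 2]
    · right; linarith only [h1, pow_pos hr' 2]
  -- ### facts about `Φ`, `ρ` on `A`, `V`; the zero extension `ρ'` of `ρ`
  have hΦmem : ∀ y ∈ A, Φ y ∈ V := fun y hy ↦ hV ▸ mem_image_of_mem Φ hy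
  have hVrep : ∀ x ∈ V, ∃ y ∈ A, Φ y = x := fun x hx ↦ (mem_image _ _ _).mp (hV ▸ hx)
  have hAV : Set.MapsTo Φ A V := fun y hy ↦ hΦmem y hy
  obtain ⟨ρ', hρ'def⟩ : ∃ ρ' : M → ℝ, ρ' = V.indicator ρ := ⟨_, rfl⟩
  have hρ'V : ∀ x ∈ V, ρ' x = ρ x := fun x hx ↦ by rw [hρ'def]; exact indicator_of_mem hx _
  have hρ'Vc : ∀ x ∉ V, ρ' x = 0 := fun x hx ↦ by rw [hρ'def]; exact indicator_of_notMem hx _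
  have hρ's : ContMDiffOn (𝓡 4) 𝓘(ℝ, ℝ) ∞ ρ' V := hρ.congr (fun x hx ↦ hρ'V x hx)
  have hρ'cont : ContinuousOn ρ' V := hρ's.continuousOn
  have hdesc' : ∀ y ∈ A, ρ' (Φ y) = ‖y‖ ^ 2 := fun y hy ↦ by rw [hρ'V _ (hΦmem y hy), hdesc y hy]
  have hρ'_nn : ∀ x, 0 ≤ ρ' x := by
    intro x; by_cases hx : x ∈ V
    · obtain ⟨y, hy, rfl⟩ := hVrep x hx
      rw [hdesc' y hy]; positivity
    · rw [hρ'Vc x hx]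
  -- ### the test function `w = W ∘ ρ'`, the auxiliary integrands `F₁`, `f₂`
  obtain ⟨w, hwdef⟩ : ∃ w : M → ℝ, w = fun x ↦ W (ρ' x) := ⟨_, rfl⟩
  obtain ⟨F₁, hF₁def⟩ : ∃ F₁ : M → ℝ, F₁ = fun x ↦ 16 * ρ' x * (deriv W (ρ' x)) ^ 2 / (1 - η) :=
    ⟨_, rfl⟩
  obtain ⟨f₂, hf₂def⟩ : ∃ f₂ : M → ℝ, f₂ = fun x ↦ -(w x ^ 2 * Real.log (w x ^ 2)) := ⟨_, rfl⟩
  have hwapp : ∀ x, w x = W (ρ' x) := fun x ↦ by rw [hwdef]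
  have hF₁app : ∀ x, F₁ x = 16 * ρ' x * (deriv W (ρ' x)) ^ 2 / (1 - η) := fun x ↦ by rw [hF₁def]
  have hf₂app : ∀ x, f₂ x = -(w x ^ 2 * Real.log (w x ^ 2)) := fun x ↦ by rw [hf₂def]
  have hwVc : ∀ x ∉ V, w x = 0 := fun x hx ↦ by rw [hwapp, hρ'Vc x hx, hW00]
  have hF₁Vc : ∀ x ∉ V, F₁ x = 0 := fun x hx ↦ by rw [hF₁app, hρ'Vc x hx]; simp
  have hwΦ : ∀ y ∈ A, w (Φ y) = W (‖y‖ ^ 2) := fun y hy ↦ by rw [hwapp, hdesc' y hy]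
  have hF₁Φ : ∀ y ∈ A, F₁ (Φ y) = 16 * ‖y‖ ^ 2 * (deriv W (‖y‖ ^ 2)) ^ 2 / (1 - η) := fun y hy ↦ by
    rw [hF₁app, hdesc' y hy]
  -- both vanish off `K`
  have hw0K : ∀ x ∉ K, w x = 0 := by
    intro x hx
    by_cases hxV : x ∈ V
    · obtain ⟨y, hy, rfl⟩ := hVrep x hxV
      have hyC : y ∉ C := fun hyC ↦ hx (hmemK y hyC)
      rw [hwΦ y hy, (hflatA y hy hyC).1]
    · exact hwVc x hxV
  have hF₁0K : ∀ x ∉ K, F₁ x = 0 := by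
    intro x hx
    by_cases hxV : x ∈ V
    · obtain ⟨y, hy, rfl⟩ := hVrep x hxV
      have hyC : y ∉ C := fun hyC ↦ hx (hmemK y hyC)
      rw [hF₁Φ y hy, (hflatA y hy hyC).2]; simp
    · exact hF₁Vc x hxV
  -- smoothness / continuity by zero extension
  have hWm : ContMDiff 𝓘(ℝ, ℝ) 𝓘(ℝ, ℝ) ∞ W := hWsmooth.contMDiff
  have hwV_smooth : ContMDiffOn (𝓡 4) 𝓘(ℝ, ℝ) ∞ w V := by
    rw [hwdef]; exact hWm.comp_contMDiffOn hρ's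
  have hws : ContMDiff (𝓡 4) 𝓘(ℝ, ℝ) ∞ w :=
    contMDiff_of_contMDiffOn_of_eq_zero hopen hKclosed hKV hwV_smooth hw0K
  have hwc : Continuous w := hws.continuous
  have hw2c : Continuous fun x ↦ w x ^ 2 := hwc.pow 2
  have hF₁V_cont : ContinuousOn F₁ V := by
    rw [hF₁def]
    exact ((continuousOn_const.mul hρ'cont).mul ((hW'cont.comp_continuousOn hρ'cont).pow 2)).div_const _
  have hF₁c : Continuous F₁ :=
    continuous_of_continuousOn_of_eq_zero hopen hKclosed hKV hF₁V_cont hF₁0K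
  have hf₂c : Continuous f₂ := by
    rw [hf₂def]; exact (Real.continuous_mul_log.comp hw2c).neg
  -- signs and sizes
  have h1η : 0 < 1 - η := by linarith only [hη1]
  have hw_nn : ∀ x, 0 ≤ w x := fun x ↦ by rw [hwapp]; exact hW0 _
  have hw_le : ∀ x, w x ≤ 1 := fun x ↦ by rw [hwapp]; exact hW1 _ (hρ'_nn x)
  have hF₁_nn : ∀ x, 0 ≤ F₁ x := fun x ↦ by
    rw [hF₁app]
    exact div_nonneg (mul_nonneg (mul_nonneg (by norm_num) (hρ'_nn x)) (sq_nonneg _)) h1η.le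
  have hf₂_nn : ∀ x, 0 ≤ f₂ x := by
    intro x
    rw [hf₂app]
    have h0 := hw_nn x
    have h1 : w x ^ 2 ≤ 1 := by
      have := hw_le x
      calc w x ^ 2 = w x * w x := sq _
        _ ≤ 1 * 1 := mul_le_mul this this h0 zero_le_one
        _ = 1 := one_mul _
    have h2 : Real.log (w x ^ 2) ≤ 0 := Real.log_nonpos (sq_nonneg _) h1
    have h3 : w x ^ 2 * Real.log (w x ^ 2) ≤ 0 := mul_nonpos_of_nonneg_of_nonpos (sq_nonneg _) h2
    linarith only [h3]
  -- ### pointwise bound `4 |∇w|² ≤ F₁`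
  have htsupp : tsupport w ⊆ K := closure_minimal (fun x hx ↦ by
    by_contra hxK; exact hx (hw0K x hxK)) hKclosed
  have hgrad_le : ∀ x, 4 * h.gradSq w x ≤ F₁ x := by
    intro x
    by_cases hxV : x ∈ V
    · obtain ⟨y, hy, rfl⟩ := hVrep x hxV
      have hρd : MDifferentiableAt (𝓡 4) 𝓘(ℝ, ℝ) ρ' (Φ y) :=
        ((hρ's _ hxV).contMDiffAt (hopen.mem_nhds hxV)).mdifferentiableAt (by simp)
      have h2 : h.gradSq w (Φ y) = (deriv W (ρ' (Φ y))) ^ 2 * h.gradSq ρ' (Φ y) := by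
        rw [hwdef]; exact h.gradSq_real_comp (hWdiff _).hasDerivAt hρd
      have h3 : h.gradSq ρ' (Φ y) ≤ 4 * ‖y‖ ^ 2 / (1 - η) :=
        gradSq_descent_le h hη1 hAo hopen hΦ hρ's hAV hdesc' hy (hmf y hy)
          (fun v ↦ (hcomp y hy v).1)
      rw [h2, hF₁Φ y hy, hdesc' y hy]
      have h4 : 0 ≤ (deriv W (‖y‖ ^ 2)) ^ 2 := sq_nonneg _
      calc 4 * (deriv W (‖y‖ ^ 2) ^ 2 * h.gradSq ρ' (Φ y))
          ≤ 4 * (deriv W (‖y‖ ^ 2) ^ 2 * (4 * ‖y‖ ^ 2 / (1 - η))) := by gcongr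
        _ = 16 * ‖y‖ ^ 2 * deriv W (‖y‖ ^ 2) ^ 2 / (1 - η) := by ring
    · -- off `V ⊇ K`, `w` vanishes near `x`
      have hxK : x ∉ tsupport w := fun hxK ↦ hxV (hKV (htsupp hxK))
      have h1 : h.gradSq w x = 0 :=
        h.gradSq_eq_zero_of_mvfderiv_eq_zero
          (Literature.Geometry.Lorentzian.mvfderiv_eq_zero_of_notMem_tsupport hxK)
      rw [h1, hF₁Vc x hxV]; simp
  -- ### pointwise bound `R w² ≤ Λ w²`
  have hRw_le : ∀ x, h.scalarCurvatureWith cov x * w x ^ 2 ≤ Λ * w x ^ 2 := by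
    intro x
    by_cases hxV : x ∈ V
    · obtain ⟨y, hy, rfl⟩ := hVrep x hxV
      have h2 : h.scalarCurvatureWith cov (Φ y) ≤ Λ := le_trans (le_abs_self _) (hRΛ y hy)
      exact mul_le_mul_of_nonneg_right h2 (sq_nonneg _)
    · rw [hwVc x hxV]; simp
  -- ### local injectivity of `Φ` (inverse function theorem)
  have hlocinj : ∀ y ∈ A, ∃ U : Set (EuclideanSpace ℝ (Fin 4)), IsOpen U ∧ y ∈ U ∧ U ⊆ A ∧
      Set.InjOn Φ U := by
    intro y hy
    have hld : IsLocalDiffeomorphAt (𝓡 4) (𝓡 4) ∞ Φ y :=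
      Literature.Topology.FourManifolds.isLocalDiffeomorphAt_of_mfderiv_injective hAo hy hΦ
        (by simp) rfl (hmf y hy)
    obtain ⟨e, hye, heq⟩ := hld
    refine ⟨e.source ∩ A, e.open_source.inter hAo, ⟨hye, hy⟩, inter_subset_right, ?_⟩
    intro a ha b hb hab
    have h1 : e a = e b := by rw [← heq ha.1, ← heq hb.1]; exact hab
    exact e.toPartialEquiv.injOn ha.1 hb.1 h1
  -- ### the `k`-sheeted comparison (Stubs 4, 5)
  have hper : ∀ U ⊆ A, IsOpen U → Set.InjOn Φ U → ∀ S ⊆ U, MeasurableSet S →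
      ENNReal.ofReal ((1 - η) ^ 2) * volume S ≤ h.riemVolume (Φ '' S) ∧
        h.riemVolume (Φ '' S) ≤ ENNReal.ofReal ((1 + η) ^ 2) * volume S := by
    intro U hUA hUo hinjU S hSU hS
    exact hS4 M h hh Φ U η hη0 hη1 hUo (hΦ.mono hUA) hinjU (fun y hy v ↦ hcomp y (hUA hy) v) S hSU hS
  have hsheet := hS5 M h hh Φ A k (ENNReal.ofReal ((1 - η) ^ 2)) (ENNReal.ofReal ((1 + η) ^ 2))
    hk hAo hΦ hlocinj (hV ▸ hopen) hfib hper
  -- ### Euclidean integrands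
  obtain ⟨g₀, hg₀⟩ : ∃ g : EuclideanSpace ℝ (Fin 4) → ℝ, g = fun y ↦ W (‖y‖ ^ 2) ^ 2 := ⟨_, rfl⟩
  obtain ⟨g₁, hg₁⟩ : ∃ g : EuclideanSpace ℝ (Fin 4) → ℝ,
      g = fun y ↦ 16 * ‖y‖ ^ 2 * (deriv W (‖y‖ ^ 2)) ^ 2 / (1 - η) := ⟨_, rfl⟩
  obtain ⟨g₂, hg₂⟩ : ∃ g : EuclideanSpace ℝ (Fin 4) → ℝ,
      g = fun y ↦ -(W (‖y‖ ^ 2) ^ 2 * Real.log (W (‖y‖ ^ 2) ^ 2)) := ⟨_, rfl⟩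
  have hg₀c : Continuous g₀ := by rw [hg₀]; exact (hWsmooth.continuous.comp hnsq).pow 2
  have hg₁c : Continuous g₁ := by
    rw [hg₁]; exact ((continuous_const.mul hnsq).mul ((hW'cont.comp hnsq).pow 2)).div_const _
  have hg₂c : Continuous g₂ := by
    rw [hg₂]; exact (Real.continuous_mul_log.comp ((hWsmooth.continuous.comp hnsq).pow 2)).neg
  have hg₀nn : ∀ y, 0 ≤ g₀ y := fun y ↦ by rw [hg₀]; exact sq_nonneg _
  have hg₁nn : ∀ y, 0 ≤ g₁ y := fun y ↦ by
    rw [hg₁]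
    exact div_nonneg (mul_nonneg (mul_nonneg (by norm_num) (sq_nonneg _)) (sq_nonneg _)) h1η.le
  have hg₂nn : ∀ y, 0 ≤ g₂ y := fun y ↦ by
    rw [hg₂]
    have h0 : 0 ≤ W (‖y‖ ^ 2) := hW0 _
    have h1 : W (‖y‖ ^ 2) ^ 2 ≤ 1 := by
      have := hW1 (‖y‖ ^ 2) (sq_nonneg _)
      calc W (‖y‖ ^ 2) ^ 2 = W (‖y‖ ^ 2) * W (‖y‖ ^ 2) := sq _
        _ ≤ 1 * 1 := mul_le_mul this this h0 zero_le_one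
        _ = 1 := one_mul _
    have h2 : Real.log (W (‖y‖ ^ 2) ^ 2) ≤ 0 := Real.log_nonpos (sq_nonneg _) h1
    have h3 := mul_nonpos_of_nonneg_of_nonpos (sq_nonneg (W (‖y‖ ^ 2))) h2
    show 0 ≤ -(W (‖y‖ ^ 2) ^ 2 * Real.log (W (‖y‖ ^ 2) ^ 2))
    linarith only [h3]
  have hint : ∀ {g : EuclideanSpace ℝ (Fin 4) → ℝ}, Continuous g → IntegrableOn g A volume :=
    fun hg ↦ (hg.continuousOn.integrableOn_compact (isCompact_closedBall _ _)).mono_set hAsub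
  -- values along `Φ` on `A`
  have hG₀Φ : ∀ y ∈ A, ENNReal.ofReal (w (Φ y) ^ 2) = ENNReal.ofReal (g₀ y) := fun y hy ↦ by
    rw [hwΦ y hy, hg₀]
  have hG₁Φ : ∀ y ∈ A, ENNReal.ofReal (F₁ (Φ y)) = ENNReal.ofReal (g₁ y) := fun y hy ↦ by
    rw [hF₁Φ y hy, hg₁]
  have hG₂Φ : ∀ y ∈ A, ENNReal.ofReal (f₂ (Φ y)) = ENNReal.ofReal (g₂ y) := fun y hy ↦ by
    rw [hf₂app, hwΦ y hy, hg₂]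
  -- ### transfer of the three integrals
  haveI : IsFiniteMeasure h.riemVolume := ⟨h.riemVolume_univ_lt_top⟩
  have htransfer : ∀ {F : M → ℝ} {g : EuclideanSpace ℝ (Fin 4) → ℝ}, Continuous F → Continuous g →
      (∀ x, 0 ≤ F x) → (∀ y, 0 ≤ g y) → (∀ x ∉ V, F x = 0) →
      (∀ y ∈ A, ENNReal.ofReal (F (Φ y)) = ENNReal.ofReal (g y)) →
      (1 - η) ^ 2 * (∫ y in A, g y ∂volume) ≤ k * ∫ x, F x ∂h.riemVolume ∧
        k * ∫ x, F x ∂h.riemVolume ≤ (1 + η) ^ 2 * (∫ y in A, g y ∂volume) := by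
    intro F g hFc hgc hFnn hgnn hF0 hFg
    have hmeas : Measurable fun x ↦ ENNReal.ofReal (F x) :=
      ENNReal.measurable_ofReal.comp hFc.measurable
    obtain ⟨hlo, hup⟩ := hsheet _ hmeas
    -- the `M`-side
    have hsupp : (Function.support fun x ↦ ENNReal.ofReal (F x)) ⊆ Φ '' A := by
      intro x hx
      by_contra hxV
      exact hx (by simp [hF0 x (hV ▸ hxV)])
    have hM : ∫⁻ x in Φ '' A, ENNReal.ofReal (F x) ∂h.riemVolume =
        ENNReal.ofReal (∫ x, F x ∂h.riemVolume) := by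
      rw [setLIntegral_eq_of_support_subset hsupp]
      exact (ofReal_integral_eq_lintegral_ofReal (h.integrable_of_continuous hFc)
        (Eventually.of_forall hFnn)).symm
    -- the Euclidean side
    have hE : ∫⁻ y in A, ENNReal.ofReal (F (Φ y)) ∂volume =
        ENNReal.ofReal (∫ y in A, g y ∂volume) := by
      rw [setLIntegral_congr_fun hAo.measurableSet hFg]
      exact (ofReal_integral_eq_lintegral_ofReal (hint hgc) (Eventually.of_forall hgnn)).symm
    rw [hM, hE] at hlo hup
    have hkZ : (k : ℝ≥0∞) * ENNReal.ofReal (∫ x, F x ∂h.riemVolume) =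
        ENNReal.ofReal (k * ∫ x, F x ∂h.riemVolume) := by
      rw [ENNReal.ofReal_mul (Nat.cast_nonneg k), ENNReal.ofReal_natCast]
    have hIg : 0 ≤ ∫ y in A, g y ∂volume := setIntegral_nonneg hAo.measurableSet (fun y _ ↦ hgnn y)
    have hIF : 0 ≤ ∫ x, F x ∂h.riemVolume := integral_nonneg hFnn
    rw [hkZ, ← ENNReal.ofReal_mul (sq_nonneg _)] at hlo
    rw [hkZ, ← ENNReal.ofReal_mul (sq_nonneg _)] at hup
    have hkF : 0 ≤ (k : ℝ) * ∫ x, F x ∂h.riemVolume := mul_nonneg (Nat.cast_nonneg k) hIF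
    have hηg : 0 ≤ (1 + η) ^ 2 * ∫ y in A, g y ∂volume := mul_nonneg (sq_nonneg _) hIg
    exact ⟨(ENNReal.ofReal_le_ofReal_iff hkF).mp hlo, (ENNReal.ofReal_le_ofReal_iff hηg).mp hup⟩
  obtain ⟨h0l, h0u⟩ := htransfer hw2c hg₀c (fun x ↦ sq_nonneg _) hg₀nn
    (fun x hx ↦ by rw [hwVc x hx]; simp) hG₀Φ
  obtain ⟨-, h1u⟩ := htransfer hF₁c hg₁c hF₁_nn hg₁nn hF₁Vc hG₁Φ
  obtain ⟨-, h2u⟩ := htransfer hf₂c hg₂c hf₂_nn hg₂nn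
    (fun x hx ↦ by rw [hf₂app, hwVc x hx]; simp) hG₂Φ
  have hJ₁nn : 0 ≤ ∫ x, F₁ x ∂h.riemVolume := integral_nonneg hF₁_nn
  have hJ₂nn : 0 ≤ ∫ x, f₂ x ∂h.riemVolume := integral_nonneg hf₂_nn
  -- ### positivity of `I₀ = ∫_A g₀`, hence of `Z = ∫ w²`
  have hI₀pos : 0 < ∫ y in A, g₀ y ∂volume := by
    have hs₀l : 2 * ε ^ 2 < (2 * ε ^ 2 + 3 * r' ^ 2 / 4) / 2 := by linarith only [hεr]
    have hs₀u : (2 * ε ^ 2 + 3 * r' ^ 2 / 4) / 2 < 3 * r' ^ 2 / 4 := by linarith only [hεr]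
    have hs₀pos : 0 < (2 * ε ^ 2 + 3 * r' ^ 2 / 4) / 2 := by positivity
    obtain ⟨y₀, hy₀⟩ : ∃ y₀ : EuclideanSpace ℝ (Fin 4),
        ‖y₀‖ = Real.sqrt ((2 * ε ^ 2 + 3 * r' ^ 2 / 4) / 2) :=
      exists_norm_eq (EuclideanSpace ℝ (Fin 4)) (Real.sqrt_nonneg _)
    have hy₀sq : ‖y₀‖ ^ 2 = (2 * ε ^ 2 + 3 * r' ^ 2 / 4) / 2 := by
      rw [hy₀, Real.sq_sqrt hs₀pos.le]
    have hy₀A : y₀ ∈ A := by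
      rw [hmemA, ← abs_of_nonneg (norm_nonneg y₀), ← abs_of_pos hε, ← abs_of_pos hr', ← sq_lt_sq,
        ← sq_lt_sq, hy₀sq]
      constructor
      · linarith only [hs₀l, pow_pos hε 2]
      · linarith only [hs₀u, pow_pos hr' 2]
    have hg₀y₀ : 0 < g₀ y₀ := by
      rw [hg₀]
      show 0 < W (‖y₀‖ ^ 2) ^ 2
      rw [hy₀sq]
      exact pow_pos (hWpos _ hs₀l hs₀u) 2
    rw [setIntegral_pos_iff_support_of_nonneg_ae (Eventually.of_forall (fun y ↦ hg₀nn y))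
      (hint hg₀c)]
    have hU : {y | 0 < g₀ y} ∩ A ∈ 𝓝 y₀ :=
      inter_mem ((isOpen_lt continuous_const hg₀c).mem_nhds hg₀y₀) (hAo.mem_nhds hy₀A)
    have hsub : {y | 0 < g₀ y} ∩ A ⊆ Function.support g₀ ∩ A :=
      fun y hy ↦ ⟨ne_of_gt hy.1, hy.2⟩
    exact lt_of_lt_of_le (Measure.measure_pos_of_mem_nhds volume hU) (measure_mono hsub)
  have hkpos : (0 : ℝ) < k := by exact_mod_cast hk
  have hZpos : 0 < ∫ x, w x ^ 2 ∂h.riemVolume := by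
    have h1 : 0 < (1 - η) ^ 2 * ∫ y in A, g₀ y ∂volume := mul_pos (pow_pos h1η 2) hI₀pos
    by_contra hZ0
    have h2 : (k : ℝ) * ∫ x, w x ^ 2 ∂h.riemVolume ≤ 0 :=
      mul_nonpos_of_nonneg_of_nonpos hkpos.le (not_lt.mp hZ0)
    linarith only [h1, h2, h0l]
  -- ### the test-function bound (Stub 3) and the annulus arithmetic
  have hμ := hS3 M h hh cov hR τ hτ w hws hZpos
  rw [hg₀, hWdef] at h0l h0u
  rw [hg₁, hWdef] at h1u
  rw [hg₂, hWdef] at h2u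
  have hfinal := harith _ _ _ h0l h0u hJ₁nn h1u hJ₂nn h2u
  -- ### comparison of the numerator
  have hgradc : Continuous (h.gradSq w) :=
    continuous_innerDual_mvfderiv h (hws.of_le (by norm_num)) (hws.of_le (by norm_num))
  have hNfc : Continuous fun x ↦ τ * (h.scalarCurvatureWith cov x * w x ^ 2 + 4 * h.gradSq w x)
      - w x ^ 2 * Real.log (w x ^ 2) :=
    (continuous_const.mul ((hR.mul hw2c).add (continuous_const.mul hgradc))).sub
      (Real.continuous_mul_log.comp hw2c)
  have hBfc : Continuous fun x ↦ τ * (Λ * w x ^ 2 + F₁ x) + f₂ x :=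
    (continuous_const.mul ((continuous_const.mul hw2c).add hF₁c)).add hf₂c
  have hNB : ∀ x, τ * (h.scalarCurvatureWith cov x * w x ^ 2 + 4 * h.gradSq w x)
      - w x ^ 2 * Real.log (w x ^ 2) ≤ τ * (Λ * w x ^ 2 + F₁ x) + f₂ x := by
    intro x
    have h3 : τ * (h.scalarCurvatureWith cov x * w x ^ 2 + 4 * h.gradSq w x) ≤
        τ * (Λ * w x ^ 2 + F₁ x) :=
      mul_le_mul_of_nonneg_left (by linarith only [hRw_le x, hgrad_le x]) hτ.le
    rw [hf₂app]
    linarith only [h3]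
  have hNle : ∫ x, τ * (h.scalarCurvatureWith cov x * w x ^ 2 + 4 * h.gradSq w x)
      - w x ^ 2 * Real.log (w x ^ 2) ∂h.riemVolume ≤ ∫ x, τ * (Λ * w x ^ 2 + F₁ x) + f₂ x ∂h.riemVolume :=
    integral_mono (h.integrable_of_continuous hNfc) (h.integrable_of_continuous hBfc) hNB
  have hBval : ∫ x, τ * (Λ * w x ^ 2 + F₁ x) + f₂ x ∂h.riemVolume =
      τ * (Λ * ∫ x, w x ^ 2 ∂h.riemVolume + ∫ x, F₁ x ∂h.riemVolume) + ∫ x, f₂ x ∂h.riemVolume := by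
    have i1 : Integrable (fun x ↦ w x ^ 2) h.riemVolume := h.integrable_of_continuous hw2c
    have i2 : Integrable F₁ h.riemVolume := h.integrable_of_continuous hF₁c
    have i3 : Integrable f₂ h.riemVolume := h.integrable_of_continuous hf₂c
    have i4 : Integrable (fun x ↦ Λ * w x ^ 2 + F₁ x) h.riemVolume := (i1.const_mul Λ).add i2
    have i5 : Integrable (fun x ↦ τ * (Λ * w x ^ 2 + F₁ x)) h.riemVolume := i4.const_mul τ
    have e1 : ∫ x, τ * (Λ * w x ^ 2 + F₁ x) + f₂ x ∂h.riemVolume =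
        (∫ x, τ * (Λ * w x ^ 2 + F₁ x) ∂h.riemVolume) + ∫ x, f₂ x ∂h.riemVolume :=
      integral_add i5 i3
    have e2 : ∫ x, τ * (Λ * w x ^ 2 + F₁ x) ∂h.riemVolume = τ * ∫ x, (Λ * w x ^ 2 + F₁ x) ∂h.riemVolume :=
      integral_const_mul τ _
    have e3 : ∫ x, (Λ * w x ^ 2 + F₁ x) ∂h.riemVolume =
        (∫ x, Λ * w x ^ 2 ∂h.riemVolume) + ∫ x, F₁ x ∂h.riemVolume := integral_add (i1.const_mul Λ) i2
    have e4 : ∫ x, Λ * w x ^ 2 ∂h.riemVolume = Λ * ∫ x, w x ^ 2 ∂h.riemVolume := integral_const_mul Λ _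
    rw [e1, e2, e3, e4]
  -- ### conclusion
  have hreal : (∫ x, τ * (h.scalarCurvatureWith cov x * w x ^ 2 + 4 * h.gradSq w x)
      - w x ^ 2 * Real.log (w x ^ 2) ∂h.riemVolume) / (∫ x, w x ^ 2 ∂h.riemVolume)
      + Real.log (∫ x, w x ^ 2 ∂h.riemVolume) - 2 * Real.log (4 * Real.pi * τ) - 4 < m := by
    have h1 := div_le_div_of_nonneg_right (hBval ▸ hNle) hZpos.le
    have h2 : (τ * (Λ * ∫ x, w x ^ 2 ∂h.riemVolume + ∫ x, F₁ x ∂h.riemVolume) +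
        ∫ x, f₂ x ∂h.riemVolume) / (∫ x, w x ^ 2 ∂h.riemVolume) =
        τ * Λ + (τ * ∫ x, F₁ x ∂h.riemVolume + ∫ x, f₂ x ∂h.riemVolume) /
          (∫ x, w x ^ 2 ∂h.riemVolume) := by
      field_simp; ring
    rw [h2] at h1
    linarith only [h1, hfinal]
  exact lt_of_le_of_lt hμ (EReal.coe_lt_coe_iff.mpr hreal)

end ConeCore


/-- **Stub 7 — the blow-down assembly** (lead). Run Stub 2 with `F = ν_cyl + δ'`; if a cone point exists,
pick it, `k ≥ 2`, `m = ν_cyl + δ' > -log 2 ≥ -log k` (`half_lt_thetaCyl`), get the thresholds of Stub 6,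
choose `r'` (the chart metric is Euclidean at `0`), `τ`, `ε`, transplant by (E6a), pass to
`h = Q g_k(t)` (`constSmul`), build `w = e^{-ρ/8τ} cut(ρ)` on `M` (smooth: supported in the image of a
compact sub-annulus), bound `|∇ρ|²_h ≤ 4ρ/(1-η)` from the metric comparison, and combine Stubs 3, 4, 5, 6
into `μ(h, τ) < m`, against the floor `μ(h, τ) = μ(g_k(t), τ/Q) ≥ m`; hence no cone point, and (E1)–(E7)
give the statement. OPEN (fact-free glue). [folklore] -/
theorem stub_blowdownAssembly :
    OrbifoldTangentFlowExport → MuEntropyTestFunctionBound → InjOnVolumeComparison →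
      MultiplicityLintegral → ConeAnnulusArithmetic → BlowdownSolitonStatement := by
  intro hN1 hS3 hS4 hS5 hS6 M _ _ _ _ _ _ _ _ _ _ A gk covk xk δ' c hδ' hc hA hflow hRiem hcurv hpt hfloor
  obtain ⟨S, i1, i2, i3, i4, i5, i7, i8, i9, gS, iLC, f, hS, W, ι, kc, rc, Λc, gc, hf, hsol, hnorm,
      hprob, hFW, hWneg, hdich, hcone, htrans, hconn, hcompl, hcouple⟩ :=
    hN1 M A gk covk xk (Real.log 2 + Real.log Real.pi / 2 - 3 / 2 + δ') c hc hA hflow hRiem hcurv hpt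
      hfloor
  by_cases hι : Nonempty ι
  · -- ### a cone point leads to a contradiction with the entropy floor
    exfalso
    obtain ⟨i⟩ := hι
    obtain ⟨hk2, hrpos, hΛnn, hgcs, hgc0, -, -⟩ := hcone i
    have hk1 : 1 ≤ kc i := le_trans (by norm_num) hk2
    obtain ⟨m, hm⟩ : ∃ m : ℝ, m = Real.log 2 + Real.log Real.pi / 2 - 3 / 2 + δ' := ⟨_, rfl⟩
    have hmk : -Real.log (kc i) < m := hm ▸ neg_log_lt_nuCyl_add hk2 hδ'
    obtain ⟨η₀, hη₀, c₀, hc₀, harith⟩ := hS6 (kc i) hk1 m hmk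
    -- parameters `η`, `r₁`, `Λ`, `τ`, `ε`
    obtain ⟨η, hηdef⟩ : ∃ η : ℝ, η = min η₀ (1 / 2) := ⟨_, rfl⟩
    have hηpos : 0 < η := hηdef ▸ lt_min hη₀ (by norm_num)
    have hηle : η ≤ η₀ := hηdef ▸ min_le_left _ _
    have hηhalf : η ≤ 1 / 2 := hηdef ▸ min_le_right _ _
    have hη1 : η < 1 := by linarith only [hηhalf]
    have hθpos : 0 < η / 3 := by positivity
    obtain ⟨r₁, hr₁, hr₁r, hgcmp⟩ :=
      exists_ball_sq_norm_comparison hrpos hθpos hgcs.continuousOn hgc0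
    have hΛ1 : 0 < Λc i + 1 := by linarith only [hΛnn]
    obtain ⟨τ, hτdef⟩ : ∃ τ : ℝ, τ = min (c₀ / (Λc i + 1)) (c₀ * r₁ ^ 2) / 2 := ⟨_, rfl⟩
    have hq1 : 0 < c₀ / (Λc i + 1) := div_pos hc₀ hΛ1
    have hq2 : 0 < c₀ * r₁ ^ 2 := by positivity
    have hτpos : 0 < τ := by rw [hτdef]; exact div_pos (lt_min hq1 hq2) two_pos
    have hτ1 : τ ≤ c₀ / (Λc i + 1) := by
      have := min_le_left (c₀ / (Λc i + 1)) (c₀ * r₁ ^ 2)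
      rw [hτdef]; linarith only [this, hq1]
    have hτ2 : τ ≤ c₀ * r₁ ^ 2 := by
      have := min_le_right (c₀ / (Λc i + 1)) (c₀ * r₁ ^ 2)
      rw [hτdef]; linarith only [this, hq2]
    have hΛτ : Λc i * τ ≤ c₀ := by
      calc Λc i * τ ≤ Λc i * (c₀ / (Λc i + 1)) := mul_le_mul_of_nonneg_left hτ1 hΛnn
        _ ≤ (Λc i + 1) * (c₀ / (Λc i + 1)) :=
            mul_le_mul_of_nonneg_right (by linarith only) hq1.le
        _ = c₀ := by field_simp
    obtain ⟨ε, hεdef⟩ : ∃ ε : ℝ, ε = min (Real.sqrt (c₀ * τ)) r₁ / 2 := ⟨_, rfl⟩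
    have hsqrtpos : 0 < Real.sqrt (c₀ * τ) := Real.sqrt_pos.mpr (by positivity)
    have hεpos : 0 < ε := by rw [hεdef]; exact div_pos (lt_min hsqrtpos hr₁) two_pos
    have hεr₁ : ε ≤ r₁ / 2 := by
      have := min_le_right (Real.sqrt (c₀ * τ)) r₁
      rw [hεdef]; linarith only [this]
    have hεsq : ε ^ 2 ≤ c₀ * τ := by
      have h1 : ε ≤ Real.sqrt (c₀ * τ) / 2 := by
        have := min_le_left (Real.sqrt (c₀ * τ)) r₁
        rw [hεdef]; linarith only [this]
      have h2 : ε ^ 2 ≤ (Real.sqrt (c₀ * τ) / 2) ^ 2 := pow_le_pow_left₀ hεpos.le h1 2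
      have h3 : (Real.sqrt (c₀ * τ) / 2) ^ 2 = c₀ * τ / 4 := by
        rw [div_pow, Real.sq_sqrt (by positivity)]; norm_num
      have h4 : 0 ≤ c₀ * τ := by positivity
      linarith only [h2, h3, h4]
    have hεlt : ε < rc i := by linarith only [hεr₁, hr₁r, hr₁]
    have hεr₁' : 8 * ε ^ 2 < 3 * r₁ ^ 2 := by nlinarith only [hεr₁, hεpos, hr₁]
    -- transplant an annulus of the cone chart into a rescaled slice of the compact flows
    obtain ⟨kₓ, t, ht, Q, hQ, Φ, ρ, hΦs, hopen, hmf, hfib, hρs, hdesc, hcmp, hRb⟩ :=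
      htrans i ε (η / 3) hεpos hεlt hθpos
    obtain ⟨Abig, hAbig⟩ : ∃ Abig : Set (EuclideanSpace ℝ (Fin 4)),
        Abig = Metric.ball 0 (rc i) \ Metric.closedBall 0 ε := ⟨_, rfl⟩
    rw [← hAbig] at hΦs hopen hmf hfib hρs hdesc hcmp hRb
    obtain ⟨A', hA'⟩ : ∃ A' : Set (EuclideanSpace ℝ (Fin 4)),
        A' = Metric.ball 0 r₁ \ Metric.closedBall 0 ε := ⟨_, rfl⟩
    have hA'sub : A' ⊆ Abig := by
      rw [hA', hAbig]; exact Set.sdiff_subset_sdiff_left (Metric.ball_subset_ball hr₁r.le)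
    have hmemA' : ∀ {y : EuclideanSpace ℝ (Fin 4)}, y ∈ A' ↔ ε < ‖y‖ ∧ ‖y‖ < r₁ := by
      intro y
      simp only [hA', Set.mem_sdiff, Metric.mem_ball, dist_zero_right, Metric.mem_closedBall, not_le]
      tauto
    have hmemAbig : ∀ {y : EuclideanSpace ℝ (Fin 4)}, y ∈ Abig ↔ ε < ‖y‖ ∧ ‖y‖ < rc i := by
      intro y
      simp only [hAbig, Set.mem_sdiff, Metric.mem_ball, dist_zero_right, Metric.mem_closedBall, not_le]
      tauto
    -- fibres over `A'` stay in `A'`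
    have hfibre : ∀ y ∈ A', ∀ y' ∈ Abig, Φ y' = Φ y → y' ∈ A' := by
      intro y hy y' hy' hyy
      have h1 : ‖y'‖ ^ 2 = ‖y‖ ^ 2 := by rw [← hdesc y' hy', ← hdesc y (hA'sub hy), hyy]
      have h2 : ‖y'‖ = ‖y‖ := by
        rcases abs_eq_abs.mp ((sq_eq_sq_iff_abs_eq_abs _ _).mp h1) with h | h
        · exact h
        · linarith only [h, norm_nonneg y, norm_nonneg y']
      rw [hmemA', h2]; exact hmemA'.mp hy
    -- the image `Φ A'` is open
    have hopen' : IsOpen (Φ '' A') := by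
      have heq : Φ '' A' = Φ '' Abig ∩ ρ ⁻¹' Set.Iio (r₁ ^ 2) := by
        ext x
        constructor
        · rintro ⟨y, hy, rfl⟩
          refine ⟨mem_image_of_mem Φ (hA'sub hy), ?_⟩
          rw [Set.mem_preimage, hdesc y (hA'sub hy), Set.mem_Iio]
          have h0 := norm_nonneg y
          have h1 := (hmemA'.mp hy).2
          nlinarith only [h0, h1]
        · rintro ⟨⟨y, hy, rfl⟩, hlt⟩
          rw [Set.mem_preimage, hdesc y hy, Set.mem_Iio] at hlt
          refine mem_image_of_mem Φ ?_
          rw [hmemA']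
          refine ⟨(hmemAbig.mp hy).1, ?_⟩
          by_contra hge
          rw [not_lt] at hge
          nlinarith only [hlt, hge, hr₁]
      rw [heq]
      exact hρs.continuousOn.isOpen_inter_preimage hopen isOpen_Iio
    -- the rescaled slice `h = Q g_k(t)`
    have hgR : (gk kₓ t).IsRiemannian := hRiem kₓ t ht
    have hhR : ((gk kₓ t).constSmul Q hQ.ne').IsRiemannian := hgR.constSmul hQ
    have hRg : ContMDiff (𝓡 4) 𝓘(ℝ, ℝ) ∞ (fun x ↦ (gk kₓ t).scalarCurvatureWith (covk kₓ t) x) :=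
      contMDiff_scalarCurvatureWith_holds (𝓡 4) M (gk kₓ t) (covk kₓ t) ((hflow kₓ).isLeviCivita t ht)
    have hRh : Continuous fun x ↦ ((gk kₓ t).constSmul Q hQ.ne').scalarCurvatureWith (covk kₓ t) x := by
      have heq : (fun x ↦ ((gk kₓ t).constSmul Q hQ.ne').scalarCurvatureWith (covk kₓ t) x) =
          fun x ↦ Q⁻¹ * (gk kₓ t).scalarCurvatureWith (covk kₓ t) x :=
        funext fun x ↦ (gk kₓ t).scalarCurvatureWith_constSmul Q hQ.ne' (covk kₓ t) x
      rw [heq]; exact continuous_const.mul hRg.continuous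
    -- the floor on the rescaled slice
    have hfloor_h : (m : EReal) ≤ ((gk kₓ t).constSmul Q hQ.ne').muEntropy (covk kₓ t) τ := by
      rw [(gk kₓ t).muEntropy_constSmul' (covk kₓ t) hQ hτpos, hm]
      exact hfloor kₓ t ht (τ / Q) (div_pos hτpos hQ)
    -- the comparison for `h` on `A'`
    have hcomp' : ∀ y ∈ A', ∀ v : EuclideanSpace ℝ (Fin 4),
        (1 - η) * ‖v‖ ^ 2 ≤ ((gk kₓ t).constSmul Q hQ.ne').val (Φ y) (mfderiv (𝓡 4) (𝓡 4) Φ y v)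
          (mfderiv (𝓡 4) (𝓡 4) Φ y v) ∧
        ((gk kₓ t).constSmul Q hQ.ne').val (Φ y) (mfderiv (𝓡 4) (𝓡 4) Φ y v)
          (mfderiv (𝓡 4) (𝓡 4) Φ y v) ≤ (1 + η) * ‖v‖ ^ 2 := by
      intro y hy v
      have hyb : y ∈ Metric.ball (0 : EuclideanSpace ℝ (Fin 4)) r₁ := by
        rw [Metric.mem_ball, dist_zero_right]; exact (hmemA'.mp hy).2
      obtain ⟨hc1, hc2⟩ := hgcmp y hyb v
      obtain ⟨ht1, ht2⟩ := hcmp y (hA'sub hy) v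
      rw [(gk kₓ t).constSmul_apply]
      have hv0 : 0 ≤ ‖v‖ ^ 2 := sq_nonneg _
      have hθ1 : 0 ≤ 1 - η / 3 := by linarith only [hη1]
      constructor
      · have e1 : (1 - η) * ‖v‖ ^ 2 ≤ (1 - η / 3) * ((1 - η / 3) * ‖v‖ ^ 2) := by
          have key : (1 - η / 3) * ((1 - η / 3) * ‖v‖ ^ 2) - (1 - η) * ‖v‖ ^ 2 =
              (η / 3 + η ^ 2 / 9) * ‖v‖ ^ 2 := by ring
          have : 0 ≤ (η / 3 + η ^ 2 / 9) * ‖v‖ ^ 2 := by positivity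
          linarith only [key, this]
        have e2 : (1 - η / 3) * ((1 - η / 3) * ‖v‖ ^ 2) ≤ (1 - η / 3) * gc i y v v :=
          mul_le_mul_of_nonneg_left hc1 hθ1
        linarith only [e1, e2, ht1]
      · have e2 : (1 + η / 3) * gc i y v v ≤ (1 + η / 3) * ((1 + η / 3) * ‖v‖ ^ 2) :=
          mul_le_mul_of_nonneg_left hc2 (by linarith only [hηpos])
        have e3 : (1 + η / 3) * ((1 + η / 3) * ‖v‖ ^ 2) ≤ (1 + η) * ‖v‖ ^ 2 := by
          have key : (1 + η) * ‖v‖ ^ 2 - (1 + η / 3) * ((1 + η / 3) * ‖v‖ ^ 2) =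
              η / 9 * (3 - η) * ‖v‖ ^ 2 := by ring
          have : 0 ≤ η / 9 * (3 - η) * ‖v‖ ^ 2 :=
            mul_nonneg (mul_nonneg (by positivity) (by linarith only [hη1])) hv0
          linarith only [key, this]
        linarith only [ht2, e2, e3]
    -- scalar curvature of `h` on `Φ A'`
    have hRΛ' : ∀ y ∈ A', |((gk kₓ t).constSmul Q hQ.ne').scalarCurvatureWith (covk kₓ t) (Φ y)| ≤ Λc i := by
      intro y hy
      rw [(gk kₓ t).scalarCurvatureWith_constSmul Q hQ.ne' (covk kₓ t), abs_mul, abs_inv, abs_of_pos hQ,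
        inv_mul_le_iff₀ hQ]
      exact hRb y (hA'sub hy)
    -- fibres and the arithmetic
    have hfib' : ∀ y ∈ A', (Φ ⁻¹' {Φ y} ∩ A').ncard = kc i := by
      intro y hy
      have heq : Φ ⁻¹' {Φ y} ∩ A' = Φ ⁻¹' {Φ y} ∩ Abig := by
        ext y'
        constructor
        · rintro ⟨h1, h2⟩; exact ⟨h1, hA'sub h2⟩
        · rintro ⟨h1, h2⟩; exact ⟨h1, hfibre y hy y' h2 h1⟩
      rw [heq]; exact hfib y (hA'sub hy)
    have harith' := harith η τ (Λc i) ε r₁ hηpos.le hηle hτpos hΛnn hΛτ hεpos hεsq hr₁ hτ2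
    rw [hA'] at hopen' hfib' hcomp' hRΛ' hA'sub
    have hlt := coneCore hS3 hS4 hS5 M ((gk kₓ t).constSmul Q hQ.ne') hhR (covk kₓ t) hRh (kc i) hk1
      m η τ (Λc i) ε r₁ hηpos.le hη1 hτpos hεpos hr₁ hεr₁' Φ ρ (hΦs.mono hA'sub) hopen'
      (fun y hy ↦ hmf y (hA'sub hy)) hfib' (hρs.mono (image_mono hA'sub))
      (fun y hy ↦ hdesc y (hA'sub hy)) hcomp' hRΛ' harith'
    exact absurd hfloor_h (not_le.mpr hlt)
  · -- ### no cone point: the export is r4's `stub_blowdownSoliton`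
    haveI hιe : IsEmpty ι := not_nonempty_iff.mp hι
    haveI : ConnectedSpace S := hconn hιe
    have hRpos : ∀ x : S, 0 < gS.scalarCurvature x := hdich.resolve_right hι
    exact ⟨S, i1, i2, i3, i4, i5, inferInstance, i7, i8, i9, gS, iLC, f, hS, W, hcompl hιe, hf, hsol,
      hnorm, hprob, hFW, hRpos, fun hSc ↦ hcouple hιe hSc⟩


/-- **r4's `stub_blowdownSoliton`, now DERIVED** from the seven registered stubs of r5. [folklore] -/
theorem stub_blowdownSoliton_derived : BlowdownSolitonStatement :=
  stub_blowdownAssembly stub_orbifoldTangentFlow stub_muEntropyTestFunction stub_injOnVolumeComparison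
    stub_multiplicityLintegral stub_coneAnnulusArithmetic

/-! ## Stub 2b (r4) — renormalisation to the route's currency: CLOSED (p74584; used below by name). -/

/-- **The r2/r3 `stub_blowdown`, DERIVED** from `stub_blowdownSoliton_derived` and `stub_renormalise`. [folklore] -/
theorem blowdown_of :
    ∀ (M : Type) [TopologicalSpace M] [T2Space M] [SecondCountableTopology M]
      [ChartedSpace (EuclideanSpace ℝ (Fin 4)) M] [IsManifold (𝓡 4) ∞ M] [CompactSpace M]
      [ConnectedSpace M] [T3Space M] [MeasurableSpace M] [BorelSpace M]
      (A : ℕ → ℝ)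
      (gk : ℕ → ℝ → PseudoRiemannianMetric (𝓡 4) ∞ (EuclideanSpace ℝ (Fin 4)) (TangentSpace (𝓡 4) : M → Type _))
      (covk : ℕ → ℝ → CovariantDerivative (𝓡 4) (EuclideanSpace ℝ (Fin 4)) (TangentSpace (𝓡 4) : M → Type _))
      (xk : ℕ → M) (δ' c : ℝ), 0 < δ' → 0 < c →
      (∀ k : ℕ, (k : ℝ) ≤ A k) →
      (∀ k, IsRicciFlow (gk k) (covk k) (Set.Icc (-(A k)) 0)) →
      (∀ k, ∀ t ∈ Set.Icc (-(A k)) 0, (gk k t).IsRiemannian) →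
      (∀ k, ∀ t ∈ Set.Icc (-(A k)) 0, CurvatureBoundedBy (gk k t) (covk k t) 1) →
      (∀ k, ∃ X Y Z W : TangentSpace (𝓡 4) (xk k),
        (gk k 0).val (xk k) X X ≤ 1 ∧ (gk k 0).val (xk k) Y Y ≤ 1 ∧
        (gk k 0).val (xk k) Z Z ≤ 1 ∧ (gk k 0).val (xk k) W W ≤ 1 ∧
        c ≤ |(gk k 0).curvatureForm (covk k 0) (xk k) X Y Z W|) →
      (∀ k, ∀ t ∈ Set.Icc (-(A k)) 0, ∀ τ : ℝ, 0 < τ →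
        ((Real.log 2 + Real.log Real.pi / 2 - 3 / 2 + δ' : ℝ) : EReal) ≤
          (gk k t).muEntropy (covk k t) τ) →
      ∃ (S : Type) (_ : TopologicalSpace S) (_ : T2Space S) (_ : SecondCountableTopology S)
        (_ : ChartedSpace (EuclideanSpace ℝ (Fin 4)) S) (_ : IsManifold (𝓡 4) ∞ S) (_ : ConnectedSpace S)
        (_ : T3Space S) (_ : MeasurableSpace S) (_ : BorelSpace S)
        (gS : PseudoRiemannianMetric (𝓡 4) ∞ (EuclideanSpace ℝ (Fin 4)) (TangentSpace (𝓡 4) : S → Type _))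
        (_ : gS.HasLeviCivita) (fS : S → ℝ) (hS : gS.IsRiemannian),
        (∀ (x : S) (r : NNReal), IsCompact {y : S | gS.edist hS x y ≤ r}) ∧
        ContMDiff (𝓡 4) 𝓘(ℝ, ℝ) ∞ fS ∧
        (∀ (x : S) (X Y : TangentSpace (𝓡 4) x),
          gS.ricci x X Y + gS.hessian fS x X Y = (1 / 2 : ℝ) * gS.val x X Y) ∧
        (∀ x : S, gS.scalarCurvature x + gS.gradSq fS x = fS x) ∧
        (∃ x : S, gS.scalarCurvature x ≠ 0) ∧
        ENNReal.ofReal (32 * Real.pi ^ 2 * Real.sqrt Real.pi * Real.exp (-(3 : ℝ) / 2)) <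
          ∫⁻ x, ENNReal.ofReal (Real.exp (-fS x))
            ∂(riemannianMeasure (gS.toContMDiffRiemannianMetric hS)) ∧
        (CompactSpace S → ∃ φ : S → M, ContMDiff (𝓡 4) (𝓡 4) ∞ φ ∧ Function.Injective φ ∧
          ∀ x : S, Function.Injective (mfderiv (𝓡 4) (𝓡 4) φ x)) := by
  intro M _ _ _ _ _ _ _ _ _ _ A gk covk xk δ' c hδ' hc hA hflow hRiem hcurv hpt hfloor
  obtain ⟨S, i1, i2, i3, i4, i5, i6, i7, i8, i9, gS, iLC, f, hS, W, hcomplete, hf, hsol, hnormW, hprob,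
      hW, hRpos, hcouple⟩ :=
    stub_blowdownSoliton_derived M A gk covk xk δ' c hδ' hc hA hflow hRiem hcurv hpt hfloor
  obtain ⟨fS, hfS, hsolS, hnormS, hnonflat, hdens⟩ :=
    _root_.Summit.SmoothPoincare4.SmoothPoincare4.Theorems.SubcylindricalRecognition.AncientSphereRigidity.stub_renormalise
      S gS f hS W δ' hδ' hf hsol hnormW hprob hW hRpos
  exact ⟨S, i1, i2, i3, i4, i5, i6, i7, i8, i9, gS, iLC, fS, hS, hcomplete, hfS, hsolS, hnormS, hnonflat,
    hdens, hcouple⟩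

/-! ## Stub 3 (r2) — compact models are recognised: CLOSED (p72507; used below by name). -/

/-! ## Composition — the crux from the stubs and its two declared route dependencies -/

/-- **The blow-up sequence** (the planner's round-1 `stub_blowupSequence`, DERIVED, sorry-free,
from `stub_singularFlow`, `stub_pointPicking`, `stub_rescaledSequence`). [folklore] -/
theorem blowupSequence_of :
    ∀ (M : Type) [TopologicalSpace M] [T2Space M] [SecondCountableTopology M]
      [ChartedSpace (EuclideanSpace ℝ (Fin 4)) M] [IsManifold (𝓡 4) ∞ M] [CompactSpace M]
      [ConnectedSpace M] [T3Space M] [MeasurableSpace M] [BorelSpace M]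
      (g : PseudoRiemannianMetric (𝓡 4) ∞ (EuclideanSpace ℝ (Fin 4)) (TangentSpace (𝓡 4) : M → Type _))
      [g.HasLeviCivita] (hg : g.IsRiemannian),
      (∀ x : M, 0 < g.scalarCurvature x) →
      (∃ δ : ℝ, 0 < δ ∧ ∀ τ : ℝ, 0 < τ → ∀ f : M → ℝ, ContMDiff (𝓡 4) 𝓘(ℝ, ℝ) ∞ f →
        ∫ x, (4 * Real.pi * τ) ^ (-(4 : ℝ) / 2) * Real.exp (-f x)
          ∂(riemannianMeasure (g.toContMDiffRiemannianMetric hg)) = 1 →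
        Real.log 2 + Real.log Real.pi / 2 - 3 / 2 + δ ≤
          ∫ x, (τ * (g.scalarCurvature x + g.gradSq f x) + f x - 4) *
            ((4 * Real.pi * τ) ^ (-(4 : ℝ) / 2) * Real.exp (-f x))
            ∂(riemannianMeasure (g.toContMDiffRiemannianMetric hg))) →
      ∃ (κ δ' c : ℝ), 0 < κ ∧ 0 < δ' ∧ 0 < c ∧
        ∃ (A : ℕ → ℝ)
          (gk : ℕ → ℝ → PseudoRiemannianMetric (𝓡 4) ∞ (EuclideanSpace ℝ (Fin 4)) (TangentSpace (𝓡 4) : M → Type _))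
          (covk : ℕ → ℝ → CovariantDerivative (𝓡 4) (EuclideanSpace ℝ (Fin 4)) (TangentSpace (𝓡 4) : M → Type _))
          (xk : ℕ → M),
          (∀ k : ℕ, (k : ℝ) ≤ A k) ∧
          (∀ k, IsRicciFlow (gk k) (covk k) (Set.Icc (-(A k)) 0)) ∧
          (∀ k, ∀ t ∈ Set.Icc (-(A k)) 0, (gk k t).IsRiemannian) ∧
          (∀ k, ∀ t ∈ Set.Icc (-(A k)) 0, CurvatureBoundedBy (gk k t) (covk k t) 1) ∧
          (∀ k, ∃ X Y Z W : TangentSpace (𝓡 4) (xk k),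
            (gk k 0).val (xk k) X X ≤ 1 ∧ (gk k 0).val (xk k) Y Y ≤ 1 ∧
            (gk k 0).val (xk k) Z Z ≤ 1 ∧ (gk k 0).val (xk k) W W ≤ 1 ∧
            c ≤ |(gk k 0).curvatureForm (covk k 0) (xk k) X Y Z W|) ∧
          (∀ k, ∀ r₀ : ℝ, 0 < r₀ → r₀ < Real.sqrt (A k) →
            IsKappaNoncollapsed (gk k) (covk k) (Set.Icc (-(A k)) 0) κ r₀) ∧
          (∀ k, ∀ t ∈ Set.Icc (-(A k)) 0, ∀ τ : ℝ, 0 < τ →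
            ((Real.log 2 + Real.log Real.pi / 2 - 3 / 2 + δ' : ℝ) : EReal) ≤
              (gk k t).muEntropy (covk k t) τ) := by
  intro M _ _ _ _ _ _ _ _ _ _ g _ hg hR hν
  obtain ⟨δ, hδ, hfloor⟩ := hν
  -- Stub 1a: the singular flow with blow-up, NLC and the floor
  obtain ⟨T, κ, hκ, gt, cov, hmax, _h0, hblow, hnc, hfl⟩ :=
    stub_singularFlow M g hg hR δ hδ hfloor
  -- Stub 1b: point picking
  obtain ⟨tk, Qk, xk, htk, hQk, hA, hbd, hpick⟩ :=
    _root_.Summit.SmoothPoincare4.SmoothPoincare4.Theorems.SubcylindricalRecognition.AncientSphereRigidity.stub_pointPicking M T gt cov hmax hblow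
  -- Stub 1c: rescaling
  exact _root_.Summit.SmoothPoincare4.SmoothPoincare4.Theorems.SubcylindricalRecognition.AncientSphereRigidity.stub_rescaledSequence M T δ κ hδ hκ gt cov hmax hnc hfl
    tk Qk xk htk hQk hA hbd hpick

/-- **RUNG from the line.** `SubcylindricalRecognition` (stmt-SmoothPoincare4-10869) follows from the
registered stubs and the route's two density gaps `NoncompactShrinkerGap` (stmt-…-10868) and
`CompactShrinkerGap` (stmt-…-10870) — the crux's declared dependencies, taken as hypotheses BY NAME.
Pure logic: blow up (`blowupSequence_of`) and blow down (`blowdown_of`); a non-compact blow-down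
contradicts `NoncompactShrinkerGap` (density `> Θ_cyl` versus `≤ Θ_cyl`); a compact one immerses
injectively into the connected `M`, hence (`stub_compactModelRecognition`) is diffeomorphic to
`M ≃ₕ S⁴`, so it is a compact shrinker on a homotopy 4-sphere of density `> Θ_cyl`, and
`CompactShrinkerGap` returns its diffeomorphism to `S⁴`. The homotopy equivalence is used twice
(connectedness of `M`; `S ≃ₕ S⁴`), as `Disproof.recognitionWithoutHomotopyEquiv_false` demands. -/
theorem SubcylindricalRecognition_of
    (h₂ : _root_.Summit.SmoothPoincare4.SmoothPoincare4.Theses.EntropyRung.NoncompactShrinkerGap)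
    (h₄ : _root_.Summit.SmoothPoincare4.SmoothPoincare4.Theses.EntropyRung.CompactShrinkerGap) :
    _root_.Summit.SmoothPoincare4.SmoothPoincare4.Theses.EntropyRung.SubcylindricalRecognition := by
  intro M _ _ _ _ _ _ _ _ _ e g _ hg hR hν
  -- `M ≃ₕ S⁴` ⇒ `M` (path) connected
  haveI : PathConnectedSpace (Metric.sphere (0 : EuclideanSpace ℝ (Fin 5)) 1) :=
    Literature.Topology.FourManifolds.pathConnectedSpace_sphere_four
  haveI : PathConnectedSpace M :=
    Literature.Topology.FourManifolds.pathConnectedSpace_of_homotopyEquiv e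
  -- Stubs 1a–1c: the blow-up sequence of rescaled flows on `M`
  obtain ⟨κ, δ', c, _hκ, hδ', hc, A, gk, covk, xk, hA, hflow, hRiem, hcurv, hpt, _hnc, hfloor⟩ :=
    blowupSequence_of M g hg hR hν
  -- Stubs 2–7 and 2b: its blow-down shrinker `S`
  obtain ⟨S, _, _, _, _, _, _, _, _, _, gS, _, fS, hS, hScomplete, hfS, hsol, hnorm, hSnonflat, hdens,
      hScouple⟩ :=
    blowdown_of M A gk covk xk δ' c hδ' hc hA hflow hRiem hcurv hpt hfloor
  by_cases hSc : CompactSpace S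
  · -- compact blow-down: `S` immerses injectively into `M`, hence `S ≅ M ≃ₕ S⁴` (Stub 3),
    -- and `CompactShrinkerGap` applies to `S`
    obtain ⟨φ, hφ, hφinj, hφimm⟩ := hScouple hSc
    obtain ⟨eSM⟩ := _root_.Summit.SmoothPoincare4.SmoothPoincare4.Theorems.SubcylindricalRecognition.AncientSphereRigidity.stub_compactModelRecognition S M φ hφ hφinj hφimm
    have eS4 : S ≃ₕ Metric.sphere (0 : EuclideanSpace ℝ (Fin 5)) 1 :=
      eSM.toHomeomorph.toHomotopyEquiv.trans e
    obtain ⟨eS⟩ := h₄ S eS4 gS fS hS hfS hsol hnorm hdens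
    exact ⟨eSM.symm.trans eS⟩
  · -- non-compact blow-down: forbidden by `NoncompactShrinkerGap`
    haveI : NoncompactSpace S := not_compactSpace_iff.mp hSc
    have hle := h₂ S gS fS hS hScomplete hfS hsol hnorm hSnonflat
    exact absurd hdens (not_lt.mpr hle)

end Summit.SmoothPoincare4.SmoothPoincare4.Cruxes.SubcylindricalRecognition.AncientSphereRigidity

end
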